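import Literature.Barriers.CriticalPhenomena.PlaquetteWalkHoleRootSevenAboveFrame
import HarnessLib

/-!
# Barrier catalogue (SAWScalingLimit): the frame of the cost-`7` vertical-end parents above the root row, II — `r` STANDS ON THE FIRST TURN («COLUMN LAW», F2)

`Z → ∞` limit model of the printed Yang–Baxter weights [GlazmanManolescu2019, §1, eq. (1)]; the «RECTANGLE COEFFICIENT» line of the venture lane «pcv-sawmu»
(b-engine-1 g26–g27), step F2 of the FRAME (DESIGN-next-g26 §4). After F1 (`ΩG.sIn_firstHit_eq_S_of_cost_seven_E_above`: the parent enters `r` from below and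
leaves west), ★★★ `ΩG.fst_eq_firstTurn_of_cost_seven_E_above`: `r` stands in the column of the FIRST TURN `p₁ = (w.1 + k, w.2)` of the walk — `r.1 = w.1 + k`
(census: «r = w₂», the second turn sits on top of the first). Six isolated turns are available: the west turn `t` of `r`'s top-row chain (entered from `E` at
`firstHitG + M`), `r`, the two bottom turns `b₀, b₁`, the root-row turn `τ` east of `p₁`, and at most one «outsider». The `S`-chain of `r` descends to an isolated
turn `e` of the column of `r`. (i) A middle-row `e`, and a root-row `e ≠ p₁, τ`, cost two outsiders. (ii) `e = τ` east of a doubly visited `p₁`: the `N`-chain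
of `p₁` then tops out at `t`, its column is straight, and the arc of `p₁` through `N` either climbs into `t` from below (but `t` is entered from `E`) or comes
down from `t` after the first hit, leaves `p₁` eastwards and runs along the root row into `τ = e`, whose only arc precedes the first hit. (iii) A bottom-row `e`
(the WALL: the column of `r` is occupied from the bottom row to the top row): the walk ends east of the column, so some arc after the first hit is the LAST one
in the column and leaves it eastwards (`YBWalk.exists_last_cross`); it is not in a straight cell, not at `r`, so the root-row cell `q` of the column is doubly
visited (else nothing is left), `τ` lies east of `q` (else `q`'s two horizontal chains end at two outsiders), and reading the column: the crossing is `q`'s second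
arc `S → E` (a crossing at `e`, or `q` entered from `E`, would need an earlier crossing that does not exist), `e` is entered from `W` after the first hit, the walk
runs from `q` east into `τ`; `τ` left downwards gives a late bottom entry (so `e` is an outsider) at `b₀`, and `b₁`'s `N`-chain a second outsider; `τ` left
upwards gives a top-row outsider east of `r`, so `e = b₁`, and the vertical chain of `p₁` decides: upwards it enters `t` from below, downwards it reaches `b₀`
and the bottom run either re-enters `e` before the first hit or leaves the bounding box. Tools: chain calculus (`PlaquetteWalkKissChains`), straight runs
(`PlaquetteWalkStraightRuns`, `PlaquetteWalkHoleRootRayArc`), the column IVT `YBWalk.exists_fst_eq_between`, and `YBWalk.eq_or_eq_of_fc_eq_three` (a rhombus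
carries at most two arcs). [GlazmanManolescu2019 §1 Fig. 1, eq. (1), Lemma 2.1, Remark 2.2; Glazman2015WeightedSAW Lemma 3.1 (proof, pp. 6–7); CourantRobbins1958 Ch. V App. §2]
-/

noncomputable section

namespace Literature.Probability.RandomPlanarGeometry.SAW.YangBaxter

open Real
open Literature.Barriers.CriticalPhenomena.PlaquetteWalk

open private fc_fh fh_add_Mv three_le_Mv from Literature.Probability.RandomPlanarGeometry.YangBaxterSAWGeneralDomain

namespace YBWalk

variable {D : Set Face} {a z : MidEdge} (γ : YBWalk D a z)

/-- Consecutive arcs lie in adjacent plaquettes: the column changes by at most one. [cite: GlazmanManolescu2019, §1, Fig. 1 (consecutive arcs lie in adjacent rhombi)] -/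
theorem fst_succ_near {i : ℕ} (hi : i + 1 < γ.arcs.length) :
    (γ.fc (i + 1)).1 ≤ (γ.fc i).1 + 1 ∧ (γ.fc i).1 ≤ (γ.fc (i + 1)).1 + 1 := by
  rcases hs : γ.sOut i with _ | _ | _ | _ <;>
    first
      | (rw [γ.fc_succ_eq_of_sOut_N hi hs]; simp only; omega)
      | (rw [(γ.fc_succ_eq_of_sOut_E hi hs).1]; simp only; omega)
      | (rw [γ.fc_succ_eq_of_sOut_S hi hs]; simp only; omega)
      | (rw [(γ.fc_succ_eq_of_sOut_W hi hs).1]; simp only; omega)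

/-- ★ **DISCRETE INTERMEDIATE VALUES OF THE COLUMN**: if the arc `i` lies in column `≤ x` and the arc `j ≥ i` in column `≥ x`, some arc between them lies in
column `x`. [cite: GlazmanManolescu2019, §1, Fig. 1 (consecutive arcs lie in adjacent rhombi)] -/
theorem exists_fst_eq_between {i j : ℕ} (hij : i ≤ j) (hj : j < γ.arcs.length) {x : ℤ} (hi : (γ.fc i).1 ≤ x) (hjx : x ≤ (γ.fc j).1) :
    ∃ l, i ≤ l ∧ l ≤ j ∧ (γ.fc l).1 = x := by
  induction j with
  | zero =>
    have ei : i = 0 := by omega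
    subst ei
    exact ⟨0, le_rfl, le_rfl, le_antisymm hi hjx⟩
  | succ j ih =>
    rcases Nat.lt_or_ge j i with hlt | hge
    · have ei : i = j + 1 := by omega
      subst ei
      exact ⟨j + 1, le_rfl, le_rfl, le_antisymm hi hjx⟩
    · rcases le_or_gt x (γ.fc j).1 with hle | hgt
      · obtain ⟨l, h1, h2, h3⟩ := ih hge (by omega) hle
        exact ⟨l, h1, by omega, h3⟩
      · have := (γ.fst_succ_near hj).1
        exact ⟨j + 1, by omega, le_rfl, by omega⟩

/-- The same with the columns decreasing. [cite: GlazmanManolescu2019, §1, Fig. 1 (consecutive arcs lie in adjacent rhombi)] -/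
theorem exists_fst_eq_between' {i j : ℕ} (hij : i ≤ j) (hj : j < γ.arcs.length) {x : ℤ} (hi : x ≤ (γ.fc i).1) (hjx : (γ.fc j).1 ≤ x) :
    ∃ l, i ≤ l ∧ l ≤ j ∧ (γ.fc l).1 = x := by
  induction j with
  | zero =>
    have ei : i = 0 := by omega
    subst ei
    exact ⟨0, le_rfl, le_rfl, le_antisymm hjx hi⟩
  | succ j ih =>
    rcases Nat.lt_or_ge j i with hlt | hge
    · have ei : i = j + 1 := by omega
      subst ei
      exact ⟨j + 1, le_rfl, le_rfl, le_antisymm hjx hi⟩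
    · rcases le_or_gt (γ.fc j).1 x with hle | hgt
      · obtain ⟨l, h1, h2, h3⟩ := ih hge (by omega) hle
        exact ⟨l, h1, by omega, h3⟩
      · have := (γ.fst_succ_near hj).2
        exact ⟨j + 1, by omega, le_rfl, by omega⟩


/-- ★ **THE LAST CROSSING OF A COLUMN**: if the arc `i` lies in column `≤ x` and the arc `j ≥ i` strictly east of column `x`, there is a last arc
`l < j` in column `x` after `i`; the next arc lies in column `x + 1` and all later arcs up to `j` lie strictly east of column `x`.
[cite: GlazmanManolescu2019, §1, Fig. 1 (consecutive arcs lie in adjacent rhombi)] -/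
theorem exists_last_cross {i j : ℕ} (hij : i ≤ j) (hj : j < γ.arcs.length) {x : ℤ} (hi : (γ.fc i).1 ≤ x) (hjx : x < (γ.fc j).1) :
    ∃ l, i ≤ l ∧ l < j ∧ (γ.fc l).1 = x ∧ (γ.fc (l + 1)).1 = x + 1 ∧ ∀ l', l < l' → l' ≤ j → x < (γ.fc l').1 := by
  induction j with
  | zero =>
    have ei : i = 0 := by omega
    subst ei; exfalso; omega
  | succ j ih =>
    rcases Nat.lt_or_ge j i with hlt | hge
    · have ei : i = j + 1 := by omega
      subst ei; exfalso; omega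
    · by_cases hxj : x < (γ.fc j).1
      · obtain ⟨l, h1, h2, h3, h4, h5⟩ := ih hge (by omega) hxj
        refine ⟨l, h1, by omega, h3, h4, fun l' hl' hl'j => ?_⟩
        rcases Nat.lt_or_ge l' (j + 1) with hl | hl
        · exact h5 l' hl' (by omega)
        · have : l' = j + 1 := by omega
          subst this; exact hjx
      · push Not at hxj
        have hnear := γ.fst_succ_near hj
        refine ⟨j, hge, by omega, by omega, by omega, fun l' hl' hl'j => ?_⟩
        have : l' = j + 1 := by omega
        subst this; exact hjx

/-- An arc whose successor lies one column further east leaves through `E`. [cite: GlazmanManolescu2019, §1, Fig. 1] -/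
theorem sOut_eq_E_of_fst_succ {i : ℕ} (hi : i + 1 < γ.arcs.length) (h : (γ.fc (i + 1)).1 = (γ.fc i).1 + 1) : γ.sOut i = .E := by
  rcases hs : γ.sOut i with _ | _ | _ | _
  · rw [(γ.fc_succ_eq_of_sOut_W hi hs).1] at h; simp only at h; omega
  · rfl
  · rw [γ.fc_succ_eq_of_sOut_S hi hs] at h; simp only at h; omega
  · rw [γ.fc_succ_eq_of_sOut_N hi hs] at h; simp only at h; omega

/-- Four pairwise distinct sides of a rhombus are all its sides. [cite: GlazmanManolescu2019, §1, Fig. 1] -/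
private theorem side_exhaust : ∀ a b c d e : Side, a ≠ b → a ≠ c → a ≠ d → b ≠ c → b ≠ d → c ≠ d →
    e = a ∨ e = b ∨ e = c ∨ e = d := by decide

/-- ★ **A RHOMBUS CARRIES AT MOST TWO ARCS**: two different arcs of a rhombus use its four sides, so a third arc has no side to enter through.
[cite: GlazmanManolescu2019, §1, Fig. 1 (the configurations `w₁`, `w₂`)] -/
theorem eq_or_eq_of_fc_eq_three {i j l : ℕ} (hi : i < γ.arcs.length) (hj : j < γ.arcs.length) (hl : l < γ.arcs.length) (hij : i ≠ j)
    (hji : γ.fc j = γ.fc i) (hli : γ.fc l = γ.fc i) : l = i ∨ l = j := by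
  by_contra h
  push Not at h
  obtain ⟨-, d1, d2, d3, d4⟩ := γ.not_straight_of_two_arcs hi hj hij hji
  obtain ⟨-, e1, e2, -, -⟩ := γ.not_straight_of_two_arcs hi hl (Ne.symm h.1) hli
  obtain ⟨-, f1, f2, -, -⟩ := γ.not_straight_of_two_arcs hj hl (Ne.symm h.2) (hli.trans hji.symm)
  rcases side_exhaust (γ.sIn i) (γ.sOut i) (γ.sIn j) (γ.sOut j) (γ.sIn l) (γ.sIn_ne_sOut hi) (Ne.symm d1) (Ne.symm d3)
      (Ne.symm d2) (Ne.symm d4) (γ.sIn_ne_sOut hj) with e | e | e | e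
  · exact e1 e
  · exact e2 e
  · exact f1 e
  · exact f2 e

end YBWalk

namespace ΩG

open private sIn_succ_of_sOut_N sIn_succ_of_sOut_S from Literature.Barriers.CriticalPhenomena.PlaquetteWalkHoleRootRowLaw
open private fc_sOut_pred_of_sIn_S fc_sOut_pred_of_sIn_N from Literature.Barriers.CriticalPhenomena.PlaquetteWalkStraightRuns

variable {D : Set Face} {w r : Face} {ω : ΩG D (w.side .W) r}

set_option maxHeartbeats 400000 in -- one theorem, ≈ 1 300 tactic lines (200 000 does not suffice; 400 000 passes on the farm)
/-- ★★★ **`r` STANDS ON THE FIRST TURN** (end side `E`): for a wound class-`B2a` walk of limit cost `7` from the hole root `w.side W` at a rhombus `r` strictly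
above the root row with `w.1 ≤ r.1`, ending on the `E` side of `r` with a turning first arc in `r`, the column of `r` is the column of the walk's first turning
arc: if the arcs `0, …, k − 1` are straight and the arc `k` turns, then `r.1 = w.1 + k`. [cite: GlazmanManolescu2019, §1, Fig. 1 and eq. (1); Lemma 2.1; Remark 2.2]
[cite: Glazman2015WeightedSAW, Lemma 3.1 (proof, pp. 6–7)] [cite: CourantRobbins1958, Ch. V Appendix §2 (the even–odd rule)] -/
theorem fst_eq_firstTurn_of_cost_seven_E_above (hh : holeFaceW w ∉ D) (hr : RootedFace D (w.side .W) r) (h : ω.IsB2a)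
    (hA : ω.AJ hr h (toC (midPt (w.side .W))) ≠ 0) (hc : cost (slotOfSide ω.1) ω.2.mids = 7) (hE : ω.1 = .E)
    (hNS : arcKind (ω.2.sIn ω.2.firstHitG) (ω.2.sOut ω.2.firstHitG) ≠ .straight) (habove : w.2 < r.2) (hcol : w.1 ≤ r.1)
    {k : ℕ} (hk : k < ω.2.arcs.length) (hstrk : ∀ i < k, arcKind (ω.2.sIn i) (ω.2.sOut i) = .straight)
    (hturnk : arcKind (ω.2.sIn k) (ω.2.sOut k) ≠ .straight) : r.1 = w.1 + k := by
  classical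
  set n := ω.2.arcs.length with hn
  have hz : ω.1 = .E ∨ ω.1 = .W := Or.inl hE
  ---------------------------------------------------------------- counts: six isolated turns
  have hd : slotDeg (slotOfSide ω.1) = 0 := by rw [hE]; rfl
  have h6 : cfgCount ω.2.mids [.corner] + cfgCount ω.2.mids [.coCorner] = 6 := by
    have hcost : cost (slotOfSide ω.1) ω.2.mids =
        cfgCount ω.2.mids [.corner] + cfgCount ω.2.mids [.coCorner] + (1 - slotDeg (slotOfSide ω.1)) := rfl
    rw [hcost, hd] at hc; omega
  let P : Face → Prop := fun f => f ∈ facesL ω.2.mids ∧ (kindsL ω.2.mids f = [.corner] ∨ kindsL ω.2.mids f = [.coCorner])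
  have hPiso : ∀ k < n, (∀ l < n, ω.2.fc l = ω.2.fc k → l = k) → arcKind (ω.2.sIn k) (ω.2.sOut k) ≠ .straight → P (ω.2.fc k) :=
    fun k hk hsv hkind => isolated_turn hk hsv hkind
  have hle6 : ∀ T : Finset Face, (∀ f ∈ T, P f) → T.card ≤ 6 := by
    intro T hT; have := YBWalk.card_le_cfgCount_add ω.2.mids T hT; omega
  have hPD : ∀ f s, ω.2.UsesSide f s → f ∈ D := by
    rintro f s ⟨i, hi, hfi, -⟩; rw [← hfi]; exact (YBWalk.arcFace_arcAt hi).2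
  ---------------------------------------------------------------- basics
  have hF := ω.fh_lt h
  have hlen : 0 < n := by omega
  have h0w : ω.2.fc 0 = w := fc_zero_eq_root w hh ω.2 hlen
  have h0W : ω.2.sIn 0 = .W := YBWalk.sIn_zero_eq_W hh ω.2 hlen
  have h0E : ω.2.sIn 0 ≠ .E := by rw [h0W]; decide
  have h0S : ω.2.sIn 0 ≠ .S := by rw [h0W]; decide
  have h0N : ω.2.sIn 0 ≠ .N := by rw [h0W]; decide
  obtain ⟨hzW, hfcZ⟩ : ω.2.sOut (n - 1) = .W ∧ ω.2.fc (n - 1) = (r.1 + 1, r.2) := by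
    rcases last_of_vertical_end hr h hz with ⟨-, h1, h2⟩ | ⟨hW, -, -⟩
    · exact ⟨h1, h2⟩
    · rw [hE] at hW; exact absurd hW (by decide)
  have hzE' : ω.2.sOut (n - 1) ≠ .E := by rw [hzW]; decide
  have hzS' : ω.2.sOut (n - 1) ≠ .S := by rw [hzW]; decide
  have hzN' : ω.2.sOut (n - 1) ≠ .N := by rw [hzW]; decide
  have hfne3 : ω.2.firstHitG + 3 ≤ n := by have := three_le_Mv hr h; have := fh_add_Mv h; unfold ΩG.Mv at *; omega
  have hfcF := (fc_fh ω hr h).1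
  have hsvr : ∀ l < n, ω.2.fc l = ω.2.fc ω.2.firstHitG → l = ω.2.firstHitG := fun l hl e => eq_firstHitG_of_fc_eq hr h hl e
  have hPr : P r := by rw [← hfcF]; exact hPiso _ hF hsvr hNS
  have hrside : ∀ s, ω.2.UsesSide r s → r.side s ≠ r.side ω.1 := by
    rintro s ⟨l, hl, hfl, hs⟩ e
    have hl' := hsvr l hl (hfl.trans hfcF.symm)
    obtain ⟨hin, hout⟩ := ω.2.side_sIn_eq_nth hl
    rw [hfl] at hin hout
    rw [← ω.2.nth_length] at e
    rcases hs with hs | hs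
    · rw [hs] at hin; have := ω.2.nth_inj (show l ≤ n by omega) le_rfl (hin.symm.trans e).symm.symm; omega
    · rw [hs] at hout; have := ω.2.nth_inj (show l + 1 ≤ n by omega) le_rfl (hout.symm.trans e).symm.symm; omega
  have hrE : ¬ω.2.UsesSide r .E := fun hu => hrside .E hu (by rw [hE])
  have hneF := ω.2.sIn_ne_sOut hF
  obtain ⟨X, hXw, hX, -⟩ := exists_left_entry_turn hh hr h hA
  obtain ⟨X', -, hX', -⟩ := exists_right_entry_turn hh hr h
  -- the first turn comes at or before the first hit, and strictly before it (`p₁` lies in the root row, `r` above it)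
  have hkF : k ≤ ω.2.firstHitG := by
    by_contra hlt
    exact hNS (hstrk _ (by omega))
  -- a turning arc uses a horizontal side and a vertical side
  have hHor : ∀ i < n, arcKind (ω.2.sIn i) (ω.2.sOut i) ≠ .straight → ω.2.UsesSide (ω.2.fc i) .W ∨ ω.2.UsesSide (ω.2.fc i) .E := by
    intro i hi hk'
    have hne := ω.2.sIn_ne_sOut hi
    have key : (ω.2.sIn i = .W ∨ ω.2.sOut i = .W) ∨ (ω.2.sIn i = .E ∨ ω.2.sOut i = .E) := by
      revert hne hk'; cases ω.2.sIn i <;> cases ω.2.sOut i <;> decide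
    rcases key with hW | hEx
    · exact Or.inl ⟨i, hi, rfl, hW⟩
    · exact Or.inr ⟨i, hi, rfl, hEx⟩
  ---------------------------------------------------------------- the top row is `r.2`; the first arc uses `S` and `W`
  have htop := top_row_of_cost_seven_vert_above hh hr h hA hc hz hNS habove
  have hNtop := forall_top_ne_N hh hr h htop habove
  have hupN : ∀ f : Face, f.2 = r.2 → ¬ω.2.UsesSide f .N := by
    rintro f hf ⟨i, hi, hfi, hs | hs⟩
    · exact (hNtop i hi (by rw [hfi, hf])).1 hs
    · exact (hNtop i hi (by rw [hfi, hf])).2 hs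
  have hsvTop : ∀ i, i < n → (ω.2.fc i).2 = r.2 → ∀ l < n, ω.2.fc l = ω.2.fc i → l = i :=
    fun i hi hrw l hl e => (top_single_visit hh hr h htop habove hi hl hrw e.symm).symm
  ---------------------------------------------------------------- the bottom turns and the root-row turn `τ`
  obtain ⟨Y', hY'w, hY', j₀, j₁, -, hj₀2, hrow₀', hN₀', hWE₀', hj₀₁, hj₁, hrow₁', hmax₁, halt'⟩ := bottom_exit_or_end hh hr h hA
  obtain ⟨hN₁', hWE₁', -, hfne'⟩ : (ω.2.sOut j₁ = .N ∧ (ω.2.sIn j₁ = .W ∨ ω.2.sIn j₁ = .E) ∧ j₀ ≠ j₁ ∧ ω.2.fc j₀ ≠ ω.2.fc j₁) := by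
    rcases halt' with hh' | ⟨-, -, hrY'⟩
    · exact hh'
    · exfalso; omega
  have hj₀ : j₀ < n := by omega
  have hsvB : ∀ k, k < n → (ω.2.fc k).2 = Y' → ∀ l < n, ω.2.fc l = ω.2.fc k → l = k :=
    fun k hk hrw l hl e => (bottom_single_visit hh hr h hY' (by omega) hk hl hrw e.symm).symm
  have hbotS := forall_bottom_ne_S hh hr h hY' (by omega)
  have hPb₀ : P (ω.2.fc j₀) := hPiso j₀ hj₀ (hsvB j₀ hj₀ hrow₀') (by rw [hN₀']; exact YBWalk.arcKind_ne_straight_of_S_WE (Or.inr rfl) hWE₀')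
  have hPb₁ : P (ω.2.fc j₁) := hPiso j₁ hj₁ (hsvB j₁ hj₁ hrow₁') (by rw [hN₁']; exact YBWalk.arcKind_ne_straight_of_WE_S hWE₁' (Or.inr rfl))
  -- the first turn `p₁ = (w.1 + k, w.2)`
  have hk₁ : k < n := hk
  have hstr := hstrk
  obtain ⟨hrun, hrunE⟩ := ω.2.initial_run hh hk₁ hstr
  obtain ⟨hfk, hWk⟩ := hrun k le_rfl
  have hp₁W : ω.2.UsesSide (w.1 + k, w.2) .W := ⟨k, hk₁, hfk, Or.inl hWk⟩
  have hkEo : ω.2.sOut k ≠ .E := by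
    intro e; apply hturnk; rw [hWk, e]; decide
  have hkNS : ω.2.sOut k = .N ∨ ω.2.sOut k = .S := by
    have hne := ω.2.sIn_ne_sOut hk₁
    rw [hWk] at hne
    revert hkEo hne; cases ω.2.sOut k <;> decide
  have hkltF : k < ω.2.firstHitG := by
    rcases lt_or_eq_of_le hkF with hlt | heq
    · exact hlt
    · exfalso
      have e : (((w.1 : ℤ) + k, w.2) : Face) = r := by rw [← hfk, heq, hfcF]
      have := congrArg Prod.snd e; simp only at this; omega
  obtain ⟨τ1, hPτ, hτ1, hτW, hτnE, hτalt⟩ : ∃ τ1 : ℤ, P (τ1, w.2) ∧ w.1 + k ≤ τ1 ∧ ω.2.UsesSide (τ1, w.2) .W ∧ ¬ω.2.UsesSide (τ1, w.2) .E ∧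
      ((τ1 = w.1 + k ∧ ¬ω.2.UsesSide (w.1 + k, w.2) .E) ∨
        (w.1 + k < τ1 ∧ ω.2.UsesSide (w.1 + k, w.2) .E ∧ (∀ m : ℕ, 1 ≤ m → (m : ℤ) ≤ τ1 - (w.1 + k) → ω.2.UsesSide (w.1 + k + m, w.2) .W) ∧
          ∀ m : ℕ, (m : ℤ) < τ1 - (w.1 + k) → ω.2.UsesSide (w.1 + k + m, w.2) .E)) := by
    by_cases hpE : ω.2.UsesSide (w.1 + k, w.2) .E
    · obtain ⟨M, hWall, hEall', hend⟩ := ω.2.chain_E hX' hpE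
      rcases hend with ⟨hM1, hnot⟩ | ⟨-, hs0⟩ | ⟨hZ, -⟩
      · obtain ⟨i', hi', hfc', hsv', -, -, -, hk'⟩ := ω.2.isolated_of_usesSide_not_opp (hWall M hM1 le_rfl) hnot
        refine ⟨w.1 + k + M, ?_, by omega, hWall M hM1 le_rfl, hnot,
          Or.inr ⟨by omega, hpE, fun m hm1 hm2 => hWall m hm1 (by omega), fun m hm => hEall' m (by omega)⟩⟩
        have := hPiso i' hi' hsv' hk'; rw [hfc'] at this; exact this
      · exact absurd hs0 h0E
      · rw [hfcZ] at hZ; have := congrArg Prod.snd hZ; simp only at this; omega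
    · obtain ⟨i', hi', hfc', hsv', -, -, -, hk'⟩ := ω.2.isolated_of_usesSide_not_opp hp₁W hpE
      refine ⟨w.1 + k, ?_, le_rfl, hp₁W, hpE, Or.inl ⟨rfl, hpE⟩⟩
      have := hPiso i' hi' hsv' hk'; rw [hfc'] at this; exact this
  -- `τ` is singly visited
  have hsvτ : ∀ i, i < n → ω.2.fc i = ((τ1 : ℤ), w.2) → ∀ l < n, ω.2.fc l = ((τ1 : ℤ), w.2) → l = i :=
    fun i hi hfi l hl hfl => ω.2.single_visit_of_not_usesSide hτnE hl hi hfl hfi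
  ---------------------------------------------------------------- F1: `r` is entered from `S` and left through `W`; the west turn `t` of its top-row chain
  obtain ⟨hSin, hWout⟩ := sIn_firstHit_eq_S_of_cost_seven_E_above hh hr h hA hc hE hNS habove hcol
  obtain ⟨M, hEall, hWall, hend⟩ := ω.2.chain_W hX ⟨_, hF, hfcF, Or.inr hWout⟩
  obtain ⟨hM1, hnotW⟩ : 1 ≤ M ∧ ¬ω.2.UsesSide (r.1 - M, r.2) .W := by
    rcases hend with hT | ⟨hA0, -⟩ | ⟨hZ, -⟩
    · exact hT
    · rw [h0w] at hA0; have := congrArg Prod.snd hA0; simp only at this; omega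
    · rw [hfcZ] at hZ; have := congrArg Prod.fst hZ; simp only at this; omega
  obtain ⟨iT, hiT, hfcT, hsvT, hET, hninT, hnoutT, hkT⟩ := ω.2.isolated_of_usesSide_not_opp (hEall M hM1 le_rfl) hnotW
  have hPt : P (r.1 - M, r.2) := by rw [← hfcT]; exact hPiso iT hiT hsvT hkT
  -- the straight cells between `t` and `r`; `t` is entered from `E` at index `firstHitG + M`
  have hcellsW : ∀ m : ℕ, 1 ≤ m → m ≤ M - 1 → ∀ i < n,
      ω.2.fc i = ((ω.2.fc ω.2.firstHitG).1 - m, (ω.2.fc ω.2.firstHitG).2) → arcKind (ω.2.sIn i) (ω.2.sOut i) = .straight := by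
    intro m hm1 hmM i hi hfi
    rw [hfcF] at hfi
    exact ω.2.straight_of_usesSide_EW (hEall m hm1 (by omega)) (hWall m (by omega)) (hupN _ rfl) i hi hfi
  have hfMn : ω.2.firstHitG + M < n := by
    by_contra hge
    push Not at hge
    obtain ⟨hfcL, -⟩ := ω.2.run_west_of_straight (j := ω.2.firstHitG) (M := n - 1 - ω.2.firstHitG) (by omega) hWout
      (fun m hm1 hmM i hi hfi => hcellsW m hm1 (by omega) i hi hfi) (n - 1 - ω.2.firstHitG) le_rfl
    rw [show ω.2.firstHitG + (n - 1 - ω.2.firstHitG) = n - 1 by omega, hfcZ, hfcF] at hfcL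
    have := congrArg Prod.fst hfcL; simp only at this; omega
  have hrunW := ω.2.run_west_of_straight (j := ω.2.firstHitG) (M := M - 1) (by omega) hWout hcellsW
  obtain ⟨hiTF, hinT⟩ : ω.2.firstHitG + M = iT ∧ ω.2.sIn iT = .E := by
    obtain ⟨hfcM1, houtM1⟩ := hrunW (M - 1) le_rfl
    rw [hfcF] at hfcM1
    obtain ⟨hfcT', hinT'⟩ := ω.2.fc_succ_eq_of_sOut_W (i := ω.2.firstHitG + (M - 1)) (by omega) houtM1
    rw [hfcM1, show ω.2.firstHitG + (M - 1) + 1 = ω.2.firstHitG + M by omega] at hfcT'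
    rw [show ω.2.firstHitG + (M - 1) + 1 = ω.2.firstHitG + M by omega] at hinT'
    have hfcT'' : ω.2.fc (ω.2.firstHitG + M) = (r.1 - M, r.2) := by rw [hfcT']; exact Prod.ext (by simp only; omega) rfl
    have e := hsvT _ hfMn (hfcT''.trans hfcT.symm)
    exact ⟨e, by rw [← e]; exact hinT'⟩
  ---------------------------------------------------------------- at most ONE isolated turn besides `t, r, b₀, b₁, τ`
  have hne_of_row : ∀ f g : Face, f.2 ≠ g.2 → f ≠ g := fun f g hfg e => hfg (by rw [e])
  have houts : ∀ g₁ g₂ : Face, P g₁ → P g₂ → g₁ ≠ g₂ →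
      g₁ ≠ ((r.1 : ℤ) - M, r.2) → g₁ ≠ r → g₁ ≠ ω.2.fc j₀ → g₁ ≠ ω.2.fc j₁ → g₁ ≠ ((τ1 : ℤ), w.2) →
      g₂ ≠ ((r.1 : ℤ) - M, r.2) → g₂ ≠ r → g₂ ≠ ω.2.fc j₀ → g₂ ≠ ω.2.fc j₁ → g₂ ≠ ((τ1 : ℤ), w.2) → False := by
    intro g₁ g₂ hg₁ hg₂ hne a1 a2 a3 a4 a5 c1 c2 c3 c4 c5
    have hT : ∀ x ∈ ({((r.1 : ℤ) - M, r.2), r, ω.2.fc j₀, ω.2.fc j₁, ((τ1 : ℤ), w.2), g₁, g₂} : Finset Face), P x := by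
      intro x hx
      simp only [Finset.mem_insert, Finset.mem_singleton] at hx
      rcases hx with rfl | rfl | rfl | rfl | rfl | rfl | rfl
      exacts [hPt, hPr, hPb₀, hPb₁, hPτ, hg₁, hg₂]
    have n01 : (((r.1 : ℤ) - M, r.2) : Face) ≠ r := by intro e; have := congrArg Prod.fst e; simp only at this; omega
    have n02 := hne_of_row ((r.1 : ℤ) - M, r.2) (ω.2.fc j₀) (by rw [hrow₀']; simp only; omega)
    have n03 := hne_of_row ((r.1 : ℤ) - M, r.2) (ω.2.fc j₁) (by rw [hrow₁']; simp only; omega)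
    have n04 := hne_of_row ((r.1 : ℤ) - M, r.2) ((τ1 : ℤ), w.2) (by simp only; omega)
    have n12 := hne_of_row r (ω.2.fc j₀) (by rw [hrow₀']; omega)
    have n13 := hne_of_row r (ω.2.fc j₁) (by rw [hrow₁']; omega)
    have n14 := hne_of_row r ((τ1 : ℤ), w.2) (by simp only; omega)
    have n23 := hfne'
    have n24 := hne_of_row (ω.2.fc j₀) ((τ1 : ℤ), w.2) (by rw [hrow₀']; simp only; omega)
    have n34 := hne_of_row (ω.2.fc j₁) ((τ1 : ℤ), w.2) (by rw [hrow₁']; simp only; omega)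
    have hcard : ({((r.1 : ℤ) - M, r.2), r, ω.2.fc j₀, ω.2.fc j₁, ((τ1 : ℤ), w.2), g₁, g₂} : Finset Face).card = 7 := by
      rw [Finset.card_insert_of_notMem (by simp only [Finset.mem_insert, Finset.mem_singleton, not_or]; exact ⟨n01, n02, n03, n04, a1.symm, c1.symm⟩),
        Finset.card_insert_of_notMem (by simp only [Finset.mem_insert, Finset.mem_singleton, not_or]; exact ⟨n12, n13, n14, a2.symm, c2.symm⟩),
        Finset.card_insert_of_notMem (by simp only [Finset.mem_insert, Finset.mem_singleton, not_or]; exact ⟨n23, n24, a3.symm, c3.symm⟩),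
        Finset.card_insert_of_notMem (by simp only [Finset.mem_insert, Finset.mem_singleton, not_or]; exact ⟨n34, a4.symm, c4.symm⟩),
        Finset.card_insert_of_notMem (by simp only [Finset.mem_insert, Finset.mem_singleton, not_or]; exact ⟨a5.symm, c5.symm⟩),
        Finset.card_insert_of_notMem (by simp only [Finset.mem_singleton]; exact hne), Finset.card_singleton]
    have := hle6 _ hT
    omega
  -- an isolated turn of the root row west of the hole, or of a middle row, is an "outsider"
  have hout_row : ∀ g : Face, g.2 = w.2 → g.1 < w.1 →
      g ≠ ((r.1 : ℤ) - M, r.2) ∧ g ≠ r ∧ g ≠ ω.2.fc j₀ ∧ g ≠ ω.2.fc j₁ ∧ g ≠ ((τ1 : ℤ), w.2) := by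
    intro g hg2 hg1
    refine ⟨hne_of_row _ _ (by rw [hg2]; simp only; omega), hne_of_row _ _ (by rw [hg2]; omega),
      hne_of_row _ _ (by rw [hg2, hrow₀']; omega), hne_of_row _ _ (by rw [hg2, hrow₁']; omega), ?_⟩
    intro e; have := congrArg Prod.fst e; simp only at this; omega
  have hout_mid : ∀ g : Face, w.2 < g.2 → g.2 < r.2 →
      g ≠ ((r.1 : ℤ) - M, r.2) ∧ g ≠ r ∧ g ≠ ω.2.fc j₀ ∧ g ≠ ω.2.fc j₁ ∧ g ≠ ((τ1 : ℤ), w.2) := by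
    intro g h1 h2
    exact ⟨hne_of_row _ _ (by simp only; omega), hne_of_row _ _ (by omega), hne_of_row _ _ (by rw [hrow₀']; omega),
      hne_of_row _ _ (by rw [hrow₁']; omega), hne_of_row _ _ (by simp only; omega)⟩
  have hout_low : ∀ g : Face, Y' < g.2 → g.2 < w.2 →
      g ≠ ((r.1 : ℤ) - M, r.2) ∧ g ≠ r ∧ g ≠ ω.2.fc j₀ ∧ g ≠ ω.2.fc j₁ ∧ g ≠ ((τ1 : ℤ), w.2) := by
    intro g h1 h2
    exact ⟨hne_of_row _ _ (by simp only; omega), hne_of_row _ _ (by omega), hne_of_row _ _ (by rw [hrow₀']; omega),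
      hne_of_row _ _ (by rw [hrow₁']; omega), hne_of_row _ _ (by simp only; omega)⟩
  -- an isolated turn of the top row east of `r` is an outsider
  have hout_top : ∀ g : Face, g.2 = r.2 → r.1 < g.1 →
      g ≠ ((r.1 : ℤ) - M, r.2) ∧ g ≠ r ∧ g ≠ ω.2.fc j₀ ∧ g ≠ ω.2.fc j₁ ∧ g ≠ ((τ1 : ℤ), w.2) := by
    intro g hg2 hg1
    refine ⟨fun e => ?_, fun e => ?_, hne_of_row _ _ (by rw [hg2, hrow₀']; omega), hne_of_row _ _ (by rw [hg2, hrow₁']; omega),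
      hne_of_row _ _ (by rw [hg2]; simp only; omega)⟩
    · have := congrArg Prod.fst e; simp only at this; omega
    · have := congrArg Prod.fst e; omega
  ---------------------------------------------------------------- chain ends, packaged
  have hEend : ∀ x y : ℤ, ω.2.UsesSide (x, y) .E → ∃ Mh : ℕ, 1 ≤ Mh ∧ P (x + Mh, y) ∧
      (∀ m : ℕ, 1 ≤ m → m ≤ Mh → ω.2.UsesSide (x + m, y) .W) ∧ (∀ m : ℕ, m < Mh → ω.2.UsesSide (x + m, y) .E) ∧
      ¬ω.2.UsesSide (x + Mh, y) .E := by
    intro x y hEx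
    obtain ⟨Mh, hW', hE', hend'⟩ := ω.2.chain_E hX' hEx
    rcases hend' with ⟨hM1', hnot⟩ | ⟨-, hs0⟩ | ⟨-, hsZ⟩
    · obtain ⟨i, hi, hfci, hsv, -, -, -, hk'⟩ := ω.2.isolated_of_usesSide_not_opp (hW' Mh hM1' le_rfl) hnot
      exact ⟨Mh, hM1', by rw [← hfci]; exact hPiso i hi hsv hk', hW', hE', hnot⟩
    · exact absurd hs0 h0E
    · exact absurd hsZ hzE'
  have hWend : ∀ x y : ℤ, ω.2.UsesSide (x, y) .W → y ≠ w.2 → y ≠ r.2 → ∃ Mh : ℕ, 1 ≤ Mh ∧ P (x - Mh, y) ∧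
      (∀ m : ℕ, 1 ≤ m → m ≤ Mh → ω.2.UsesSide (x - m, y) .E) ∧ (∀ m : ℕ, m < Mh → ω.2.UsesSide (x - m, y) .W) ∧
      ¬ω.2.UsesSide (x - Mh, y) .W := by
    intro x y hW hyw hyr
    obtain ⟨Mh, hE', hW', hend'⟩ := ω.2.chain_W hX hW
    rcases hend' with ⟨hM1', hnot⟩ | ⟨hA0, -⟩ | ⟨hZ, -⟩
    · obtain ⟨i, hi, hfci, hsv, -, -, -, hk'⟩ := ω.2.isolated_of_usesSide_not_opp (hE' Mh hM1' le_rfl) hnot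
      exact ⟨Mh, hM1', by rw [← hfci]; exact hPiso i hi hsv hk', hE', hW', hnot⟩
    · rw [h0w] at hA0; have := congrArg Prod.snd hA0; simp only at this; exact absurd this hyw
    · rw [hfcZ] at hZ; have := congrArg Prod.snd hZ; simp only at this; exact absurd this hyr
  have hNend : ∀ x y : ℤ, ω.2.UsesSide (x, y) .N → ∃ Mv : ℕ, 1 ≤ Mv ∧ y + Mv ≤ r.2 ∧ P (x, y + Mv) ∧
      (∀ m : ℕ, 1 ≤ m → m ≤ Mv → ω.2.UsesSide (x, y + m) .S) ∧ (∀ m : ℕ, m < Mv → ω.2.UsesSide (x, y + m) .N) ∧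
      ¬ω.2.UsesSide (x, y + Mv) .N ∧ (ω.2.UsesSide (x, y + Mv) .W ∨ ω.2.UsesSide (x, y + Mv) .E) ∧
      ∃ i < n, ω.2.fc i = (x, y + Mv) ∧ (∀ l < n, ω.2.fc l = ω.2.fc i → l = i) ∧ (ω.2.sIn i = .S ∨ ω.2.sOut i = .S) ∧
        arcKind (ω.2.sIn i) (ω.2.sOut i) ≠ .straight := by
    intro x y hN
    obtain ⟨Mv, hS', hN', hend'⟩ := ω.2.chain_N htop hN
    obtain ⟨hM1', hnot⟩ : 1 ≤ Mv ∧ ¬ω.2.UsesSide (x, y + Mv) .N := by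
      rcases hend' with hT | ⟨-, hs0⟩ | ⟨-, hsZ⟩
      · exact hT
      · exact absurd hs0 h0N
      · exact absurd hsZ hzN'
    obtain ⟨i, hi, hfci, hsv, hSi, -, -, hk'⟩ := ω.2.isolated_of_usesSide_not_opp (hS' Mv hM1' le_rfl) hnot
    refine ⟨Mv, hM1', ?_, ?_, hS', hN', hnot, ?_, i, hi, hfci, hsv, hSi, hk'⟩
    · have := htop i hi; rw [hfci] at this; exact this
    · rw [← hfci]; exact hPiso i hi hsv hk'
    · rw [← hfci]; exact hHor i hi hk'
  have hSend : ∀ x y : ℤ, ω.2.UsesSide (x, y) .S → ∃ Mv : ℕ, 1 ≤ Mv ∧ Y' ≤ y - Mv ∧ P (x, y - Mv) ∧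
      (∀ m : ℕ, 1 ≤ m → m ≤ Mv → ω.2.UsesSide (x, y - m) .N) ∧ (∀ m : ℕ, m < Mv → ω.2.UsesSide (x, y - m) .S) ∧
      ¬ω.2.UsesSide (x, y - Mv) .S ∧ (ω.2.UsesSide (x, y - Mv) .W ∨ ω.2.UsesSide (x, y - Mv) .E) ∧
      ∃ i < n, ω.2.fc i = (x, y - Mv) ∧ (∀ l < n, ω.2.fc l = ω.2.fc i → l = i) ∧ (ω.2.sIn i = .N ∨ ω.2.sOut i = .N) ∧
        arcKind (ω.2.sIn i) (ω.2.sOut i) ≠ .straight := by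
    intro x y hS
    obtain ⟨Mv, hN', hS', hend'⟩ := ω.2.chain_S hY' hS
    obtain ⟨hM1', hnot⟩ : 1 ≤ Mv ∧ ¬ω.2.UsesSide (x, y - Mv) .S := by
      rcases hend' with hT | ⟨-, hs0⟩ | ⟨-, hsZ⟩
      · exact hT
      · exact absurd hs0 h0S
      · exact absurd hsZ hzS'
    obtain ⟨i, hi, hfci, hsv, hNi, -, -, hk'⟩ := ω.2.isolated_of_usesSide_not_opp (hN' Mv hM1' le_rfl) hnot
    refine ⟨Mv, hM1', ?_, ?_, hN', hS', hnot, ?_, i, hi, hfci, hsv, hNi, hk'⟩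
    · have := hY' i hi; rw [hfci] at this; exact this
    · rw [← hfci]; exact hPiso i hi hsv hk'
    · rw [← hfci]; exact hHor i hi hk'
  ---------------------------------------------------------------- outsider killers
  -- a horizontal chain from an isolated turn `g` of a row strictly between the bottom row and the top row, other than the root row, ends at a second outsider
  have hmid_kill : ∀ (g : Face), P g → Y' < g.2 → g.2 < r.2 → g.2 ≠ w.2 → (ω.2.UsesSide g .W ∨ ω.2.UsesSide g .E) → False := by
    intro g hPg h1 h2 h3 hgEW
    have hog : ∀ g' : Face, g'.2 = g.2 →
        g' ≠ ((r.1 : ℤ) - M, r.2) ∧ g' ≠ r ∧ g' ≠ ω.2.fc j₀ ∧ g' ≠ ω.2.fc j₁ ∧ g' ≠ ((τ1 : ℤ), w.2) := by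
      intro g' hg'
      rcases lt_or_gt_of_ne h3 with hl | hg
      · exact hout_low g' (by omega) (by omega)
      · exact hout_mid g' (by omega) (by omega)
    obtain ⟨p1, p2, p3, p4, p5⟩ := hog g rfl
    rcases hgEW with hW | hEx
    · obtain ⟨M₁, hM₁, hP₁, -, -, -⟩ := hWend g.1 g.2 hW h3 (by omega)
      obtain ⟨c1, c2, c3, c4, c5⟩ := hog (g.1 - M₁, g.2) rfl
      exact houts _ _ hPg hP₁ (fun e => by have := congrArg Prod.fst e; simp only at this; omega) p1 p2 p3 p4 p5 c1 c2 c3 c4 c5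
    · obtain ⟨M₂, hM₂, hP₂, -, -, -⟩ := hEend g.1 g.2 hEx
      obtain ⟨c1, c2, c3, c4, c5⟩ := hog (g.1 + M₂, g.2) rfl
      exact houts _ _ hPg hP₂ (fun e => by have := congrArg Prod.fst e; simp only at this; omega) p1 p2 p3 p4 p5 c1 c2 c3 c4 c5
  -- hence no plaquette of such a row with a `W`-chain: its end would be such a turn
  have hWkill : ∀ x y : ℤ, ω.2.UsesSide (x, y) .W → Y' < y → y < r.2 → y ≠ w.2 → False := by
    intro x y hW h1 h2 h3
    obtain ⟨M₁, hM₁, hP₁, hE₁, -, -⟩ := hWend x y hW h3 (by omega)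
    exact hmid_kill _ hP₁ h1 h2 h3 (Or.inr (hE₁ M₁ hM₁ le_rfl))
  -- and a vertical chain end strictly inside such a row is impossible
  have hNtop_of : ∀ x y : ℤ, ∀ Mv : ℕ, P (x, y + Mv) → w.2 ≤ y → y + Mv ≤ r.2 →
      (ω.2.UsesSide (x, y + Mv) .W ∨ ω.2.UsesSide (x, y + Mv) .E) → 1 ≤ Mv → y + Mv = r.2 := by
    intro x y Mv hP hy hle hU hM
    rcases lt_or_eq_of_le hle with hlt | heq
    · exact (hmid_kill _ hP (by simp only; omega) (by simp only; exact hlt) (by simp only; omega) hU).elim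
    · exact heq
  have hSbot_of : ∀ x y : ℤ, ∀ Mv : ℕ, P (x, y - Mv) → y ≤ w.2 → Y' ≤ y - Mv →
      (ω.2.UsesSide (x, y - Mv) .W ∨ ω.2.UsesSide (x, y - Mv) .E) → 1 ≤ Mv → y - Mv = Y' := by
    intro x y Mv hP hy hle hU hM
    rcases lt_or_eq_of_le hle with hlt | heq
    · exact (hmid_kill _ hP (by simp only; exact hlt) (by simp only; omega) (by simp only; omega) hU).elim
    · exact heq.symm
  ---------------------------------------------------------------- the column under `r`: its `S`-chain ends at an isolated turn `e = (r.1, r.2 − Mc)`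
  obtain ⟨Mc, hNc, hSc, hendc⟩ := ω.2.chain_S hY' ⟨_, hF, hfcF, Or.inl hSin⟩
  obtain ⟨hMc1, hnotS⟩ : 1 ≤ Mc ∧ ¬ω.2.UsesSide (r.1, r.2 - Mc) .S := by
    rcases hendc with hT | ⟨-, hs0⟩ | ⟨-, hsZ⟩
    · exact hT
    · exact absurd hs0 h0S
    · exact absurd hsZ hzS'
  obtain ⟨iE, hiE, hfcE, hsvE, hNE, hninE, hnoutE, hkE⟩ := ω.2.isolated_of_usesSide_not_opp (hNc Mc hMc1 le_rfl) hnotS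
  have hPe : P (r.1, r.2 - Mc) := by rw [← hfcE]; exact hPiso iE hiE hsvE hkE
  have heY' : Y' ≤ r.2 - Mc := by have := hY' iE hiE; rw [hfcE] at this; exact this
  have hneE := ω.2.sIn_ne_sOut hiE
  have heUses : ω.2.UsesSide (r.1, r.2 - Mc) .W ∨ ω.2.UsesSide (r.1, r.2 - Mc) .E := by rw [← hfcE]; exact hHor iE hiE hkE
  by_contra hrk
  ---------------------------------------------------------------- `e` is not on a middle row (two outsiders): it is on the root row or below
  have hMc : (r.2 : ℤ) - w.2 ≤ Mc := by
    by_contra hlt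
    exact hmid_kill _ hPe (by simp only; omega) (by simp only; omega) (by simp only; omega) heUses
  -- the column cells strictly between `e` and `r` other than the root-row cell `q = (r.1, w.2)` are straight
  have hcolSt : ∀ m : ℕ, 1 ≤ m → m < Mc → (r.2 : ℤ) - m ≠ w.2 → ∀ i < n, ω.2.fc i = (r.1, r.2 - m) →
      arcKind (ω.2.sIn i) (ω.2.sOut i) = .straight :=
    fun m hm1 hmM hmw => ω.2.straight_of_usesSide_NS (hNc m hm1 hmM.le) (hSc m hmM)
      (fun hW => hWkill _ _ hW (by omega) (by omega) hmw)
  -- reading the column backwards from `r`: the cell `(r.1, r.2 − m)`, `m ≤ M₀ = r.2 − w.2 − 1`, is crossed upwards by the arc `firstHitG − m`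
  set M₀ : ℕ := (r.2 - w.2 - 1).toNat with hM₀
  have hM₀' : (M₀ : ℤ) = r.2 - w.2 - 1 := by omega
  have hcellsS : ∀ m : ℕ, 1 ≤ m → m ≤ M₀ → ∀ i < n,
      ω.2.fc i = ((ω.2.fc ω.2.firstHitG).1, (ω.2.fc ω.2.firstHitG).2 - m) → arcKind (ω.2.sIn i) (ω.2.sOut i) = .straight := by
    intro m hm1 hmM i hi hfi
    rw [hfcF] at hfi
    exact hcolSt m hm1 (by omega) (by omega) i hi hfi
  have hM₀F : M₀ + 1 ≤ ω.2.firstHitG := by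
    by_contra hlt
    push Not at hlt
    obtain ⟨-, hin0⟩ := ω.2.run_back_below_of_straight hF le_rfl hSin
      (fun m hm1 hmM i hi hfi => hcellsS m hm1 (by omega) i hi hfi) ω.2.firstHitG le_rfl
    rw [Nat.sub_self, h0W] at hin0
    exact absurd hin0 (by decide)
  have hrunS := ω.2.run_back_below_of_straight hF (show M₀ ≤ ω.2.firstHitG by omega) hSin hcellsS
  -- the arc `iq := firstHitG − (M₀ + 1)` lies in `q` and leaves it through `N`
  obtain ⟨hfcq, hNq⟩ : ω.2.fc (ω.2.firstHitG - (M₀ + 1)) = (r.1, w.2) ∧ ω.2.sOut (ω.2.firstHitG - (M₀ + 1)) = .N := by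
    obtain ⟨hfcM, hinM⟩ := hrunS M₀ le_rfl
    rw [hfcF] at hfcM
    obtain ⟨hfc', hout'⟩ := fc_sOut_pred_of_sIn_S ω.2 (i := ω.2.firstHitG - M₀) (by omega) (by omega) hinM
    rw [show ω.2.firstHitG - M₀ - 1 = ω.2.firstHitG - (M₀ + 1) by omega] at hfc' hout'
    refine ⟨?_, hout'⟩
    rw [hfc', hfcM]; exact Prod.ext rfl (by simp only; omega)
  set iq := ω.2.firstHitG - (M₀ + 1) with hiq
  have hiqn : iq < n := by omega
  -- the column cells above the root row, with their arcs `firstHitG − m`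
  have hupidx : ∀ l < n, ∀ m : ℕ, 1 ≤ m → m ≤ M₀ → ω.2.fc l = (r.1, r.2 - m) → l = ω.2.firstHitG - m := by
    intro l hl m hm1 hmM hfl
    obtain ⟨hfcm, -⟩ := hrunS m hmM
    rw [hfcF] at hfcm
    by_contra hne
    have := (ω.2.not_straight_of_two_arcs (show ω.2.firstHitG - m < n by omega) hl (Ne.symm hne) (hfl.trans hfcm.symm)).1
    exact this (ω.2.sOut_of_straight (by omega) (hcellsS m hm1 hmM _ (by omega) (by rw [hfcF]; exact hfcm)))
  rcases lt_or_eq_of_le hMc with hlow | hroot'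
  swap
  · ---------------------------------------------------------------- `e` on the root row: `e = p₁` (done) or two outsiders, or `e = τ` east of a doubly visited `p₁`
    have hroot : (r.2 : ℤ) - Mc = w.2 := by omega
    rw [hroot] at hfcE hPe heUses hnotS
    have hiqE : iq = iE := hsvE _ hiqn (hfcq.trans hfcE.symm)
    -- the survivor configuration `e = τ` (so `τ1 = r.1 > w.1 + k`, `p₁` doubly visited) is excluded by reading the column of `p₁`
    have hsurv : (τ1 : ℤ) = r.1 → False := by
      intro hτr
      obtain ⟨hτgt, hpE, hτWs, hτEs⟩ : w.1 + (k : ℤ) < τ1 ∧ ω.2.UsesSide (w.1 + k, w.2) .E ∧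
          (∀ m : ℕ, 1 ≤ m → (m : ℤ) ≤ τ1 - (w.1 + k) → ω.2.UsesSide (w.1 + k + m, w.2) .W) ∧
          ∀ m : ℕ, (m : ℤ) < τ1 - (w.1 + k) → ω.2.UsesSide (w.1 + k + m, w.2) .E := by
        rcases hτalt with ⟨heq, -⟩ | h4
        · exact (hrk (hτr.symm.trans heq)).elim
        · exact h4
      -- `p₁` is doubly visited: it uses `N`
      obtain ⟨b, hb, hfb, hbE⟩ := hpE
      have hkb : k ≠ b := by
        rintro rfl
        rw [hWk] at hbE
        rcases hbE with e | e
        · exact absurd e (by decide)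
        · exact hkEo e
      have hp₁N : ω.2.UsesSide (w.1 + k, w.2) .N := by
        rw [← hfk]; exact ω.2.usesSide_of_fc_eq hk₁ hb hkb (hfk.trans hfb.symm) .N
      -- its `N`-chain ends on the top row, at `t`
      obtain ⟨Mξ, hMξ1, hξrow, hPξ, hSξc, hNξc, hnotNξ, hξUses, iξ, hiξ, hfcξ, hsvξ, -, hkξ⟩ := hNend _ _ hp₁N
      have hMξr : w.2 + (Mξ : ℤ) = r.2 := hNtop_of _ _ _ hPξ le_rfl hξrow hξUses hMξ1
      rw [hMξr] at hfcξ hPξ hξUses hnotNξ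
      have hkt : (w.1 : ℤ) + k = r.1 - M := by
        rcases lt_trichotomy ((w.1 : ℤ) + k) (r.1 - M) with hlt | heq | hgt
        · -- west of `t`: `ξ` and the end of its horizontal chain are two top-row outsiders
          exfalso
          have p1 : (((w.1 : ℤ) + k, r.2) : Face) ≠ ((r.1 : ℤ) - M, r.2) := fun e => by
            have := congrArg Prod.fst e; simp only at this; omega
          have p2 : (((w.1 : ℤ) + k, r.2) : Face) ≠ r := fun e => by have := congrArg Prod.fst e; simp only at this; omega
          have p3 := hne_of_row (((w.1 : ℤ) + k, r.2) : Face) (ω.2.fc j₀) (by rw [hrow₀']; simp only; omega)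
          have p4 := hne_of_row (((w.1 : ℤ) + k, r.2) : Face) (ω.2.fc j₁) (by rw [hrow₁']; simp only; omega)
          have p5 := hne_of_row (((w.1 : ℤ) + k, r.2) : Face) ((τ1 : ℤ), w.2) (by simp only; omega)
          rcases hξUses with hW | hEx
          · obtain ⟨M₁, hE₁, -, hend₁⟩ := ω.2.chain_W hX hW
            rcases hend₁ with ⟨hM1', hnot⟩ | ⟨hA0, -⟩ | ⟨hZ, -⟩
            · obtain ⟨i₁, hi₁, hfc₁, hsv₁, -, -, -, hk₁'⟩ := ω.2.isolated_of_usesSide_not_opp (hE₁ M₁ hM1' le_rfl) hnot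
              have hP₁ : P ((w.1 : ℤ) + k - M₁, r.2) := by rw [← hfc₁]; exact hPiso i₁ hi₁ hsv₁ hk₁'
              exact houts _ _ hPξ hP₁ (fun e => by have := congrArg Prod.fst e; simp only at this; omega) p1 p2 p3 p4 p5
                (fun e => by have := congrArg Prod.fst e; simp only at this; omega)
                (fun e => by have := congrArg Prod.fst e; simp only at this; omega)
                (hne_of_row _ _ (by rw [hrow₀']; simp only; omega)) (hne_of_row _ _ (by rw [hrow₁']; simp only; omega))
                (hne_of_row _ _ (by simp only; omega))
            · rw [h0w] at hA0; have := congrArg Prod.snd hA0; simp only at this; omega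
            · rw [hfcZ] at hZ; have := congrArg Prod.fst hZ; simp only at this; omega
          · obtain ⟨M₂, hM₂, hP₂, hW₂, -, -⟩ := hEend _ _ hEx
            -- the chain does not pass `t`, which does not use `W`
            have hM₂t : (w.1 : ℤ) + k + M₂ < r.1 - M := by
              by_contra hge
              have := hW₂ (r.1 - M - (w.1 + k)).toNat (by omega) (by omega)
              rw [show (w.1 : ℤ) + k + ((r.1 - M - (w.1 + k)).toNat : ℕ) = r.1 - M by omega] at this
              exact hnotW this
            exact houts _ _ hPξ hP₂ (fun e => by have := congrArg Prod.fst e; simp only at this; omega) p1 p2 p3 p4 p5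
              (fun e => by have := congrArg Prod.fst e; simp only at this; omega)
              (fun e => by have := congrArg Prod.fst e; simp only at this; omega)
              (hne_of_row _ _ (by rw [hrow₀']; simp only; omega)) (hne_of_row _ _ (by rw [hrow₁']; simp only; omega))
              (hne_of_row _ _ (by simp only; omega))
        · exact heq
        · -- strictly between `t` and `r`: a turn in a straight cell
          exfalso
          have hm : 1 ≤ (r.1 - (w.1 + k)).toNat ∧ (r.1 - (w.1 + k)).toNat ≤ M - 1 := ⟨by omega, by omega⟩
          have e : (((r.1 : ℤ) - ((r.1 - (w.1 + k)).toNat : ℕ), r.2) : Face) = ((w.1 : ℤ) + k, r.2) :=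
            Prod.ext (by simp only; omega) rfl
          exact hkξ (hcellsW _ hm.1 hm.2 iξ hiξ (by rw [hfcF, e, hfcξ]))
      -- so `ξ = t`; the column between `p₁` and `t` is straight
      have hpcol : ∀ m : ℕ, 1 ≤ m → m < Mξ → ∀ i < n, ω.2.fc i = (w.1 + k, w.2 + m) →
          arcKind (ω.2.sIn i) (ω.2.sOut i) = .straight :=
        fun m hm1 hmM => ω.2.straight_of_usesSide_NS (hNξc m hmM) (hSξc m hm1 hmM.le)
          (fun hW => hWkill _ _ hW (by omega) (by omega) (by omega))
      -- which arc of `p₁` uses `N`, and how?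
      obtain ⟨c, hc, hfcc, hcN⟩ := hp₁N
      rcases hcN with hcin | hcout
      · ---- `p₁` entered from `N` at index `c`: the walk came down from `t`, so `c > firstHitG`, and then leaves `p₁` eastwards and runs into `τ = e`,
        ---- whose only arc precedes the first hit
        have hcells_up : ∀ m : ℕ, 1 ≤ m → m ≤ Mξ - 1 → ∀ i < n,
            ω.2.fc i = ((ω.2.fc c).1, (ω.2.fc c).2 + m) → arcKind (ω.2.sIn i) (ω.2.sOut i) = .straight := by
          intro m hm1 hmM i hi hfi; rw [hfcc] at hfi; exact hpcol m hm1 (by omega) i hi hfi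
        have hMξc : Mξ - 1 ≤ c := by
          by_contra hlt
          push Not at hlt
          obtain ⟨-, hin0⟩ := ω.2.run_back_above_of_straight hc le_rfl hcin
            (fun m hm1 hmM i hi hfi => hcells_up m hm1 (by omega) i hi hfi) c le_rfl
          rw [Nat.sub_self, h0W] at hin0; exact absurd hin0 (by decide)
        obtain ⟨hfcu, hinu⟩ := ω.2.run_back_above_of_straight hc hMξc hcin hcells_up (Mξ - 1) le_rfl
        rw [hfcc] at hfcu
        have h1u : 1 ≤ c - (Mξ - 1) := by
          by_contra hlt
          have e0 : c - (Mξ - 1) = 0 := by omega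
          rw [e0, h0W] at hinu; exact absurd hinu (by decide)
        obtain ⟨hfct, houtt⟩ := fc_sOut_pred_of_sIn_N ω.2 (i := c - (Mξ - 1)) (by omega) h1u hinu
        rw [hfcu, show c - (Mξ - 1) - 1 = c - Mξ by omega] at hfct
        have hfct' : ω.2.fc (c - Mξ) = (r.1 - M, r.2) := by
          rw [hfct]; exact Prod.ext (by simp only; omega) (by simp only; omega)
        have hct : c - Mξ = iT := hsvT _ (by omega) (hfct'.trans hfcT.symm)
        have hcgt : ω.2.firstHitG < c := by omega
        -- `p₁` is left through `E` at index `c`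
        have hcS : ω.2.sOut c ≠ .S := by
          intro hs
          have := (ω.2.not_straight_of_two_arcs hc hk₁ (by omega) (hfk.trans hfcc.symm)).1
          rw [hcin, hs] at this; exact this rfl
        have hcW : ω.2.sOut c ≠ .W := by
          intro hs
          obtain ⟨-, houtc⟩ := ω.2.side_sIn_eq_nth hc
          obtain ⟨hink, -⟩ := ω.2.side_sIn_eq_nth hk₁
          rw [hfcc, hs] at houtc
          rw [hfk, hWk] at hink
          have := ω.2.nth_inj (show c + 1 ≤ n by omega) (show k ≤ n by omega) (houtc.symm.trans hink)
          omega
        have hcEo : ω.2.sOut c = .E := by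
          have hne := ω.2.sIn_ne_sOut hc
          rw [hcin] at hne
          revert hcS hcW hne; cases ω.2.sOut c <;> decide
        -- the cells strictly between `p₁` and `τ = e` are straight
        have hrowSt : ∀ m : ℕ, 1 ≤ m → (m : ℤ) < r.1 - (w.1 + k) → ∀ i < n, ω.2.fc i = (w.1 + k + m, w.2) →
            arcKind (ω.2.sIn i) (ω.2.sOut i) = .straight := by
          intro m hm1 hm2
          refine ω.2.straight_of_usesSide_EW (s := .N) (hτEs m (by omega)) (hτWs m hm1 (by omega)) ?_
          intro hN
          obtain ⟨M₃, hM₃1, h₃row, hP₃, -, -, -, h₃Uses, i₃, hi₃, hfc₃, -, -, hk₃⟩ := hNend _ _ hN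
          have h₃top := hNtop_of _ _ _ hP₃ le_rfl h₃row h₃Uses hM₃1
          -- on the top row strictly between `t` and `r`: a straight cell
          have hmm : 1 ≤ (r.1 - (w.1 + k + m)).toNat ∧ (r.1 - (w.1 + k + m)).toNat ≤ M - 1 := ⟨by omega, by omega⟩
          have e : (((r.1 : ℤ) - ((r.1 - (w.1 + k + m)).toNat : ℕ), r.2) : Face) = ((w.1 : ℤ) + k + m, w.2 + M₃) :=
            Prod.ext (by simp only; omega) (by simp only; omega)
          exact hk₃ (hcellsW _ hmm.1 hmm.2 i₃ hi₃ (by rw [hfcF, e, hfc₃]))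
        have hcellsE : ∀ m : ℕ, 1 ≤ m → m ≤ (r.1 - (w.1 + k)).toNat - 1 → ∀ i < n,
            ω.2.fc i = ((ω.2.fc c).1 + m, (ω.2.fc c).2) → arcKind (ω.2.sIn i) (ω.2.sOut i) = .straight := by
          intro m hm1 hm2 i hi hfi; rw [hfcc] at hfi; exact hrowSt m hm1 (by omega) i hi hfi
        have hcMn : c + (r.1 - (w.1 + k)).toNat < n := by
          by_contra hge
          push Not at hge
          obtain ⟨hfcL, -⟩ := ω.2.run_east_of_straight (j := c) (M := n - 1 - c) (by omega) hcEo
            (fun m hm1 hmM i hi hfi => hcellsE m hm1 (by omega) i hi hfi) (n - 1 - c) le_rfl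
          rw [show c + (n - 1 - c) = n - 1 by omega, hfcZ, hfcc] at hfcL
          have := congrArg Prod.snd hfcL; simp only at this; omega
        obtain ⟨hfcL, houtL⟩ := ω.2.run_east_of_straight (j := c) (M := (r.1 - (w.1 + k)).toNat - 1) (by omega) hcEo hcellsE _ le_rfl
        rw [hfcc] at hfcL
        obtain ⟨hfcτ', -⟩ := ω.2.fc_succ_eq_of_sOut_E (i := c + ((r.1 - (w.1 + k)).toNat - 1)) (by omega) houtL
        rw [hfcL, show c + ((r.1 - (w.1 + k)).toNat - 1) + 1 = c + (r.1 - (w.1 + k)).toNat by omega] at hfcτ'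
        have hfcτ'' : ω.2.fc (c + (r.1 - (w.1 + k)).toNat) = (r.1, w.2) := by
          rw [hfcτ']; exact Prod.ext (by simp only; omega) rfl
        have := hsvE _ hcMn (hfcτ''.trans hfcE.symm)
        omega
      · ---- `p₁` left through `N` at index `c`: the walk climbs straight to `t` and enters it from below — but `t` is entered from `E`
        have hcells_up : ∀ m : ℕ, 1 ≤ m → m ≤ Mξ - 1 → ∀ i < n,
            ω.2.fc i = ((ω.2.fc c).1, (ω.2.fc c).2 + m) → arcKind (ω.2.sIn i) (ω.2.sOut i) = .straight := by
          intro m hm1 hmM i hi hfi; rw [hfcc] at hfi; exact hpcol m hm1 (by omega) i hi hfi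
        have hcMn : c + Mξ < n := by
          by_contra hge
          push Not at hge
          obtain ⟨hfcL, -⟩ := ω.2.run_up_of_straight (j := c) (M := n - 1 - c) (by omega) hcout
            (fun m hm1 hmM i hi hfi => hcells_up m hm1 (by omega) i hi hfi) (n - 1 - c) le_rfl
          rw [show c + (n - 1 - c) = n - 1 by omega, hfcZ, hfcc] at hfcL
          have := congrArg Prod.fst hfcL; simp only at this; omega
        obtain ⟨hfcL, houtL⟩ := ω.2.run_up_of_straight (j := c) (M := Mξ - 1) (by omega) hcout hcells_up _ le_rfl
        rw [hfcc] at hfcL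
        have hfct' := ω.2.fc_succ_eq_of_sOut_N (i := c + (Mξ - 1)) (by omega) houtL
        have hint' := sIn_succ_of_sOut_N ω.2 (i := c + (Mξ - 1)) (by omega) houtL
        rw [hfcL, show c + (Mξ - 1) + 1 = c + Mξ by omega] at hfct'
        rw [show c + (Mξ - 1) + 1 = c + Mξ by omega] at hint'
        have hfct'' : ω.2.fc (c + Mξ) = (r.1 - M, r.2) := by
          rw [hfct']; exact Prod.ext (by simp only; omega) (by simp only; omega)
        have := hsvT _ hcMn (hfct''.trans hfcT.symm)
        rw [this, hinT] at hint'
        exact absurd hint' (by decide)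
    have heτ : ((r.1 : ℤ), w.2) ≠ ((τ1 : ℤ), w.2) := fun e => hsurv (by have := congrArg Prod.fst e; simpa using this.symm)
    -- an isolated turn of the root row east of the hole other than `τ` is an outsider
    have hout_east : ∀ g : Face, g.2 = w.2 → g ≠ ((τ1 : ℤ), w.2) →
        g ≠ ((r.1 : ℤ) - M, r.2) ∧ g ≠ r ∧ g ≠ ω.2.fc j₀ ∧ g ≠ ω.2.fc j₁ ∧ g ≠ ((τ1 : ℤ), w.2) := by
      intro g hg2 hgτ
      exact ⟨hne_of_row _ _ (by rw [hg2]; simp only; omega), hne_of_row _ _ (by rw [hg2]; omega),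
        hne_of_row _ _ (by rw [hg2, hrow₀']; omega), hne_of_row _ _ (by rw [hg2, hrow₁']; omega), hgτ⟩
    obtain ⟨p1, p2, p3, p4, p5⟩ := hout_east (r.1, w.2) rfl heτ
    rcases lt_or_gt_of_ne hrk with hlt' | hgt
    · -- `e` on the initial straight run: a turn in a straight cell
      have hm₀ : (r.1 - w.1).toNat < k := by omega
      obtain ⟨hfm, -⟩ := hrun (r.1 - w.1).toNat hm₀.le
      have hsm := hstr _ hm₀
      have hfe : ω.2.fc (r.1 - w.1).toNat = ω.2.fc iE := by rw [hfm, hfcE]; exact Prod.ext (by simp only; omega) rfl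
      have := hsvE _ (by omega) hfe
      rw [this] at hsm
      exact hkE hsm
    rcases heUses with hW | hEx
    · -- `e` uses `W`: its west chain
      obtain ⟨M₁, hE₁, hW₁, hend₁⟩ := ω.2.chain_W hX hW
      rcases hend₁ with ⟨hM1', hnot⟩ | ⟨hA0, -⟩ | ⟨hZ, -⟩
      · obtain ⟨i₁, hi₁, hfc₁, hsv₁, -, -, -, hk₁'⟩ := ω.2.isolated_of_usesSide_not_opp (hE₁ M₁ hM1' le_rfl) hnot
        have hP₁ : P (r.1 - M₁, w.2) := by rw [← hfc₁]; exact hPiso i₁ hi₁ hsv₁ hk₁'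
        -- the end `g = (r.1 − M₁, w.2)` lies strictly east of `p₁`
        have hgE : (w.1 : ℤ) + k < r.1 - M₁ := by
          by_contra hle
          push Not at hle
          rcases lt_or_eq_of_le hle with hlt'' | heq'
          · -- then `p₁` is a chain cell and so is every cell down to `g`; `g` west of `p₁`: on the initial run (a straight cell) or at/behind `w`
            have hgw : (w.1 : ℤ) ≤ r.1 - M₁ := by
              by_contra hlt3
              -- the chain passes `w` and reaches the hole column
              have hD := hPD _ _ (hE₁ (r.1 - (w.1 - 1)).toNat (by omega) (by omega))
              simp only at hD
              have e : ((r.1 : ℤ) - ((r.1 - (w.1 - 1)).toNat : ℕ), w.2) = holeFaceW w := by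
                simp only [holeFaceW]; exact Prod.ext (by simp only; omega) rfl
              rw [e] at hD; exact hh hD
            have hm' : (r.1 - M₁ - w.1).toNat < k := by omega
            obtain ⟨hfm', -⟩ := hrun (r.1 - M₁ - w.1).toNat hm'.le
            have hsm' := hstr _ hm'
            have hfe' : ω.2.fc (r.1 - M₁ - w.1).toNat = ω.2.fc i₁ := by rw [hfm', hfc₁]; exact Prod.ext (by simp only; omega) rfl
            have := hsv₁ _ (by omega) hfe'
            rw [this] at hsm'
            exact hk₁' hsm'
          · -- `g = p₁`: but `p₁` uses `W`
            apply hnot; rw [show (r.1 : ℤ) - M₁ = w.1 + k by omega]; exact hp₁W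
        have hgτ : ((r.1 : ℤ) - M₁, w.2) ≠ ((τ1 : ℤ), w.2) := by
          intro e; apply hτnE; rw [← e]; exact hE₁ M₁ hM1' le_rfl
        obtain ⟨c1, c2, c3, c4, c5⟩ := hout_east (r.1 - M₁, w.2) rfl hgτ
        exact houts _ _ hPe hP₁ (fun e => by have := congrArg Prod.fst e; simp only at this; omega) p1 p2 p3 p4 p5 c1 c2 c3 c4 c5
      · -- the chain reaches `w`: then it passes `p₁` (which therefore uses `E`) and `τ` sits between `p₁` and `e`, or is `e`, or beyond `e`
        rw [h0w] at hA0
        have hM₁w : (M₁ : ℤ) = r.1 - w.1 := by have := congrArg Prod.fst hA0; simp only at this; omega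
        have hpE' : ω.2.UsesSide (w.1 + k, w.2) .E := by
          have := hE₁ (r.1 - w.1 - k).toNat (by omega) (by omega)
          rwa [show (r.1 : ℤ) - ((r.1 - w.1 - k).toNat : ℕ) = w.1 + k by omega] at this
        rcases hτalt with ⟨-, hnE⟩ | ⟨hτgt, -, hτWs, hτEs⟩
        · exact hnE hpE'
        rcases lt_trichotomy (τ1 : ℤ) r.1 with hτlt | hτeq | hτgt'
        · apply hτnE
          have := hE₁ (r.1 - τ1).toNat (by omega) (by omega)
          rwa [show (r.1 : ℤ) - ((r.1 - τ1).toNat : ℕ) = τ1 by omega] at this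
        · exact hsurv hτeq
        · -- `e` interior to `p₁`'s chain: it would use `E` as well, three sides for one arc
          have heE : ω.2.UsesSide (r.1, w.2) .E := by
            have := hτEs (r.1 - (w.1 + k)).toNat (by omega)
            rwa [show (w.1 : ℤ) + k + ((r.1 - (w.1 + k)).toNat : ℕ) = r.1 by omega] at this
          obtain ⟨a, ha, hfa, hsa⟩ := hW
          obtain ⟨b, hb, hfb, hsb⟩ := heE
          have ea := hsvE a ha (hfa.trans hfcE.symm)
          have eb := hsvE b hb (hfb.trans hfcE.symm)
          rw [ea] at hsa; rw [eb] at hsb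
          revert hsa hsb hNE hneE; cases ω.2.sIn iE <;> cases ω.2.sOut iE <;> decide
      · rw [hfcZ] at hZ; have := congrArg Prod.snd hZ; simp only at this; omega
    · -- `e` uses `E` (and not `W`): its east chain ends at a second outsider
      have henW : ¬ω.2.UsesSide (r.1, w.2) .W := by
        rintro ⟨a, ha, hfa, hsa⟩
        obtain ⟨b, hb, hfb, hsb⟩ := hEx
        have ea := hsvE a ha (hfa.trans hfcE.symm)
        have eb := hsvE b hb (hfb.trans hfcE.symm)
        rw [ea] at hsa; rw [eb] at hsb
        revert hsa hsb hNE hneE; cases ω.2.sIn iE <;> cases ω.2.sOut iE <;> decide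
      -- `τ` is west of `e`
      have hτlt : (τ1 : ℤ) < r.1 := by
        rcases hτalt with ⟨heq', -⟩ | ⟨-, -, hτWs, -⟩
        · omega
        · by_contra hge
          push Not at hge
          rcases lt_or_eq_of_le hge with hgt' | heq'
          · apply henW
            have := hτWs (r.1 - (w.1 + k)).toNat (by omega) (by omega)
            rwa [show (w.1 : ℤ) + k + ((r.1 - (w.1 + k)).toNat : ℕ) = r.1 by omega] at this
          · exact hsurv heq'.symm
      obtain ⟨M₂, hW₂, -, hend₂⟩ := ω.2.chain_E hX' hEx
      rcases hend₂ with ⟨hM1', hnot⟩ | ⟨hA0, -⟩ | ⟨-, hsZ⟩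
      · obtain ⟨i₁, hi₁, hfc₁, hsv₁, -, -, -, hk₁'⟩ := ω.2.isolated_of_usesSide_not_opp (hW₂ M₂ hM1' le_rfl) hnot
        have hP₁ : P (r.1 + M₂, w.2) := by rw [← hfc₁]; exact hPiso i₁ hi₁ hsv₁ hk₁'
        obtain ⟨c1, c2, c3, c4, c5⟩ := hout_east (r.1 + M₂, w.2) rfl (fun e => by have := congrArg Prod.fst e; simp only at this; omega)
        exact houts _ _ hPe hP₁ (fun e => by have := congrArg Prod.fst e; simp only at this; omega) p1 p2 p3 p4 p5 c1 c2 c3 c4 c5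
      · rw [h0w] at hA0; have := congrArg Prod.fst hA0; simp only at this; omega
      · exact absurd hsZ hzE'
  · ---------------------------------------------------------------- `e` below the root row: `e` is on the bottom row (a lower middle row costs two outsiders) — THE WALL
    have heq : (r.2 : ℤ) - Mc = Y' := by
      rcases lt_or_eq_of_le heY' with hlt | heq
      · exact (hmid_kill _ hPe (by simp only; exact hlt) (by simp only; omega) (by simp only; omega) heUses).elim
      · exact heq.symm
    have hqN : ω.2.UsesSide (r.1, w.2) .N := by rw [← hfcq]; exact ⟨iq, hiqn, rfl, Or.inr hNq⟩
    have hqS : ω.2.UsesSide (r.1, w.2) .S := by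
      have := hSc (M₀ + 1) (by omega)
      rwa [show (r.2 : ℤ) - ((M₀ + 1 : ℕ) : ℤ) = w.2 by push_cast; omega] at this
    -- `q` is not on the initial run: `w.1 + k < r.1`
    have hrk' : w.1 + (k : ℤ) < r.1 := by
      rcases lt_or_gt_of_ne hrk with hlt' | hgt
      · exfalso
        have hm₀ : (r.1 - w.1).toNat < k := by omega
        obtain ⟨hfm, hWm⟩ := hrun (r.1 - w.1).toNat hm₀.le
        have hsm := hstr _ hm₀
        have hout := ω.2.sOut_of_straight (show (r.1 - w.1).toNat < n by omega) hsm
        obtain ⟨j, hj, hfj, hs⟩ := hqN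
        have hfj' : ω.2.fc j = ω.2.fc (r.1 - w.1).toNat := by rw [hfj, hfm]; exact Prod.ext (by simp only; omega) rfl
        have ej : j = (r.1 - w.1).toNat := by
          by_contra hne
          exact (ω.2.not_straight_of_two_arcs (show (r.1 - w.1).toNat < n by omega) hj (Ne.symm hne) hfj').1 hout
        rw [ej, hWm] at hs
        rw [hWm] at hout
        rcases hs with hs | hs
        · exact absurd hs (by decide)
        · rw [hout] at hs; exact absurd hs (by decide)
      · exact hgt
    -- `τ ≠ q` (`q` uses `N`, `S` and — if it were `τ` — `W` but not `E`: three sides for one arc)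
    have hτq : (τ1 : ℤ) ≠ r.1 := by
      intro e
      rw [e] at hτW hτnE
      obtain ⟨a, ha, hfa, hsa⟩ := hqN
      obtain ⟨b, hb, hfb, hsb⟩ := hqS
      obtain ⟨c, hc', hfc', hsc⟩ := hτW
      have eab := ω.2.single_visit_of_not_usesSide hτnE ha hb hfa hfb
      have eac := ω.2.single_visit_of_not_usesSide hτnE ha hc' hfa hfc'
      subst eab; subst eac
      have hne := ω.2.sIn_ne_sOut ha
      revert hsa hsb hsc hne; cases ω.2.sIn a <;> cases ω.2.sOut a <;> decide
    by_cases hqW : ω.2.UsesSide (r.1, w.2) .W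
    swap
    · ---- `q` carries a straight arc: the whole column is crossed upwards before the first hit, and the walk cannot end east of it
      have hqSt : ∀ i < n, ω.2.fc i = (r.1, w.2) → arcKind (ω.2.sIn i) (ω.2.sOut i) = .straight :=
        ω.2.straight_of_usesSide_NS hqN hqS hqW
      have hallSt : ∀ m : ℕ, 1 ≤ m → m ≤ Mc - 1 → ∀ i < n,
          ω.2.fc i = ((ω.2.fc ω.2.firstHitG).1, (ω.2.fc ω.2.firstHitG).2 - m) → arcKind (ω.2.sIn i) (ω.2.sOut i) = .straight := by
        intro m hm1 hmM i hi hfi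
        rw [hfcF] at hfi
        by_cases hmw : (r.2 : ℤ) - m = w.2
        · rw [hmw] at hfi; exact hqSt i hi hfi
        · exact hcolSt m hm1 (by omega) hmw i hi hfi
      have hMcF : Mc - 1 ≤ ω.2.firstHitG := by
        by_contra hlt
        push Not at hlt
        obtain ⟨-, hin0⟩ := ω.2.run_back_below_of_straight hF le_rfl hSin
          (fun m hm1 hmM i hi hfi => hallSt m hm1 (by omega) i hi hfi) ω.2.firstHitG le_rfl
        rw [Nat.sub_self, h0W] at hin0
        exact absurd hin0 (by decide)
      have hrunAll := ω.2.run_back_below_of_straight hF hMcF hSin hallSt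
      obtain ⟨hfcb, hinb⟩ := hrunAll (Mc - 1) le_rfl
      rw [hfcF] at hfcb
      have h1b : 1 ≤ ω.2.firstHitG - (Mc - 1) := by
        by_contra hlt
        have e0 : ω.2.firstHitG - (Mc - 1) = 0 := by omega
        rw [e0, h0W] at hinb; exact absurd hinb (by decide)
      obtain ⟨hfce', -⟩ := fc_sOut_pred_of_sIn_S ω.2 (i := ω.2.firstHitG - (Mc - 1)) (by omega) h1b hinb
      rw [hfcb, show ω.2.firstHitG - (Mc - 1) - 1 = ω.2.firstHitG - Mc by omega] at hfce'
      have hfce'' : ω.2.fc (ω.2.firstHitG - Mc) = (r.1, r.2 - Mc) := by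
        rw [hfce']; exact Prod.ext rfl (by simp only; omega)
      have hiE' : ω.2.firstHitG - Mc = iE := hsvE _ (by omega) (hfce''.trans hfcE.symm)
      -- every arc in column `r.1` has index `≤ firstHitG`
      have hCle : ∀ l < n, (ω.2.fc l).1 = r.1 → l ≤ ω.2.firstHitG := by
        intro l hl hcol1
        have hr1 : Y' ≤ (ω.2.fc l).2 := hY' l hl
        have hr2 : (ω.2.fc l).2 ≤ r.2 := htop l hl
        obtain ⟨m, hm⟩ : ∃ m : ℕ, (m : ℤ) = r.2 - (ω.2.fc l).2 := ⟨(r.2 - (ω.2.fc l).2).toNat, by omega⟩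
        have hfl : ω.2.fc l = (r.1, r.2 - m) := Prod.ext hcol1 (by simp only; omega)
        rcases Nat.eq_zero_or_pos m with hm0 | hmpos
        · have : ω.2.fc l = ω.2.fc ω.2.firstHitG := by rw [hfl, hfcF, hm0]; exact Prod.ext rfl (by simp only; omega)
          exact (hsvr l hl this).le
        rcases Nat.lt_or_ge m Mc with hmlt | hmge
        · obtain ⟨hfcm, -⟩ := hrunAll m (by omega)
          rw [hfcF] at hfcm
          by_contra hgt
          have hne : ω.2.firstHitG - m ≠ l := by omega
          have := (ω.2.not_straight_of_two_arcs (show ω.2.firstHitG - m < n by omega) hl hne (hfl.trans hfcm.symm)).1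
          exact this (ω.2.sOut_of_straight (by omega) (hallSt m (by omega) (by omega) _ (by omega) (by rw [hfcF]; exact hfcm)))
        · have hmeq : m = Mc := by omega
          have : ω.2.fc l = ω.2.fc iE := by rw [hfl, hfcE, hmeq]
          have := hsvE l hl this; omega
      obtain ⟨l, hl1, hl2, hcl, -, -⟩ := ω.2.exists_last_cross (i := ω.2.firstHitG + 1) (j := n - 1) (by omega) (by omega) (x := r.1)
        (by rw [(ω.2.fc_succ_eq_of_sOut_W (i := ω.2.firstHitG) (by omega) hWout).1, hfcF]; simp only; omega)
        (by rw [hfcZ]; simp only; omega)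
      have := hCle l (by omega) hcl
      omega
    · ---- `q` is doubly visited
      -- `τ` is east of `q`: otherwise the two horizontal chains of `q` end at two root-row outsiders
      have hτgt : r.1 < (τ1 : ℤ) := by
        by_contra hle
        have hτlt : (τ1 : ℤ) < r.1 := lt_of_le_of_ne (not_lt.1 hle) hτq
        obtain ⟨M₁, hE₁, -, hend₁⟩ := ω.2.chain_W hX hqW
        -- the chain does not reach the column of `τ` (`τ` does not use `E`)
        have hM₁τ : (τ1 : ℤ) < r.1 - M₁ := by
          by_contra hge
          have := hE₁ (r.1 - τ1).toNat (by omega) (by omega)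
          apply hτnE
          have e2 : ((((r.1 : ℤ), w.2) : Face).1 - (((r.1 - τ1).toNat : ℕ) : ℤ), (((r.1 : ℤ), w.2) : Face).2) = ((τ1 : ℤ), w.2) :=
            Prod.ext (by simp only; omega) rfl
          rwa [e2] at this
        obtain ⟨hP₁, hM1'⟩ : P ((r.1 : ℤ) - M₁, w.2) ∧ 1 ≤ M₁ := by
          rcases hend₁ with ⟨hM1', hnot⟩ | ⟨hA0, -⟩ | ⟨hZ, -⟩
          · obtain ⟨i₁, hi₁, hfc₁, hsv₁, -, -, -, hk₁'⟩ := ω.2.isolated_of_usesSide_not_opp (hE₁ M₁ hM1' le_rfl) hnot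
            exact ⟨by rw [← hfc₁]; exact hPiso i₁ hi₁ hsv₁ hk₁', hM1'⟩
          · rw [h0w] at hA0; have := congrArg Prod.fst hA0; simp only at this; omega
          · rw [hfcZ] at hZ; have := congrArg Prod.snd hZ; simp only at this; omega
        have hqE : ω.2.UsesSide (r.1, w.2) .E := by
          by_contra hnE
          obtain ⟨a, ha, hfa, hsa⟩ := hqN
          obtain ⟨b, hb, hfb, hsb⟩ := hqS
          obtain ⟨c, hc', hfc', hsc⟩ := hqW
          have eab := ω.2.single_visit_of_not_usesSide hnE ha hb hfa hfb
          have eac := ω.2.single_visit_of_not_usesSide hnE ha hc' hfa hfc'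
          subst eab; subst eac
          have hne := ω.2.sIn_ne_sOut ha
          revert hsa hsb hsc hne; cases ω.2.sIn a <;> cases ω.2.sOut a <;> decide
        obtain ⟨M₂, hM₂, hP₂, -, -, -⟩ := hEend _ _ hqE
        exact houts _ _ hP₁ hP₂ (fun e => by have := congrArg Prod.fst e; simp only at this; omega)
          (hne_of_row _ _ (by simp only; omega)) (hne_of_row _ _ (by simp only; omega))
          (hne_of_row _ _ (by rw [hrow₀']; simp only; omega)) (hne_of_row _ _ (by rw [hrow₁']; simp only; omega))
          (fun e => by have := congrArg Prod.fst e; simp only at this; omega)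
          (hne_of_row _ _ (by simp only; omega)) (hne_of_row _ _ (by simp only; omega))
          (hne_of_row _ _ (by rw [hrow₀']; simp only; omega)) (hne_of_row _ _ (by rw [hrow₁']; simp only; omega))
          (fun e => by have := congrArg Prod.fst e; simp only at this; omega)
      -- so `q` is interior to `p₁`'s `E`-chain: `p₁` is doubly visited and `τ` lies east of `q`
      obtain ⟨hpE, hτWs, hτEs⟩ : ω.2.UsesSide (w.1 + k, w.2) .E ∧
          (∀ m : ℕ, 1 ≤ m → (m : ℤ) ≤ τ1 - (w.1 + k) → ω.2.UsesSide (w.1 + k + m, w.2) .W) ∧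
          ∀ m : ℕ, (m : ℤ) < τ1 - (w.1 + k) → ω.2.UsesSide (w.1 + k + m, w.2) .E := by
        rcases hτalt with ⟨heq', -⟩ | ⟨-, h1, h2, h3⟩
        · exfalso; omega
        · exact ⟨h1, h2, h3⟩
      ---- the two arcs of `q`: `iq` (`h → N`, before the first hit) and `iq'` (through `S` and the other horizontal side)
      obtain ⟨iq', hiq'n, hfcq', hSq'⟩ := hqS
      have hqq : iq ≠ iq' := by
        intro e
        rw [← e] at hSq'
        have hSin' : ω.2.sIn iq = .S := by
          rcases hSq' with h' | h'
          · exact h'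
          · rw [hNq] at h'; exact absurd h' (by decide)
        obtain ⟨c, hc', hfc', hsc⟩ := hqW
        have hcq : c ≠ iq := by
          rintro rfl
          rw [hSin', hNq] at hsc
          rcases hsc with h' | h' <;> exact absurd h' (by decide)
        have := (ω.2.not_straight_of_two_arcs hiqn hc' (Ne.symm hcq) (hfc'.trans hfcq.symm)).1
        rw [hSin', hNq] at this; exact this rfl
      obtain ⟨hturnq, d1, d2, d3, d4⟩ := ω.2.not_straight_of_two_arcs hiqn hiq'n hqq (hfcq'.trans hfcq.symm)
      rw [hNq] at hturnq d2 d4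
      have hqidx : ∀ l < n, ω.2.fc l = (r.1, w.2) → l = iq ∨ l = iq' :=
        fun l hl hfl => ω.2.eq_or_eq_of_fc_eq_three hiqn hiq'n hl hqq (hfcq'.trans hfcq.symm) (hfl.trans hfcq.symm)
      have hinq : ω.2.sIn iq = .W ∨ ω.2.sIn iq = .E := by
        have hne := ω.2.sIn_ne_sOut hiqn
        rw [hNq] at hne
        revert hturnq hne; cases ω.2.sIn iq <;> decide
      ---- classification of the arcs in column `r.1`
      have hCcls : ∀ l < n, (ω.2.fc l).1 = r.1 →
          l = ω.2.firstHitG ∨ (∃ m : ℕ, 1 ≤ m ∧ m ≤ M₀ ∧ l = ω.2.firstHitG - m) ∨ (l = iq ∨ l = iq') ∨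
            (∃ m : ℕ, M₀ + 2 ≤ m ∧ m ≤ Mc - 1 ∧ ω.2.fc l = (r.1, r.2 - m)) ∨ l = iE := by
        intro l hl hcol1
        have hr1 : Y' ≤ (ω.2.fc l).2 := hY' l hl
        have hr2 : (ω.2.fc l).2 ≤ r.2 := htop l hl
        obtain ⟨m, hm⟩ : ∃ m : ℕ, (m : ℤ) = r.2 - (ω.2.fc l).2 := ⟨(r.2 - (ω.2.fc l).2).toNat, by omega⟩
        have hfl : ω.2.fc l = (r.1, r.2 - m) := Prod.ext hcol1 (by simp only; omega)
        rcases Nat.eq_zero_or_pos m with hm0 | hmpos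
        · left; apply hsvr l hl; rw [hfl, hfcF, hm0]; exact Prod.ext rfl (by simp only; omega)
        rcases Nat.lt_or_ge M₀ m with hmgt | hmle
        swap
        · right; left; exact ⟨m, hmpos, hmle, hupidx l hl m hmpos hmle hfl⟩
        rcases Nat.lt_or_ge m (M₀ + 2) with hmq | hmq
        · right; right; left
          have hmq' : m = M₀ + 1 := by omega
          exact hqidx l hl (by rw [hfl, hmq']; exact Prod.ext rfl (by simp only; push_cast; omega))
        rcases Nat.lt_or_ge m Mc with hmMc | hmMc
        · right; right; right; left; exact ⟨m, hmq, by omega, hfl⟩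
        · right; right; right; right
          have hmMc' : m = Mc := by omega
          apply hsvE l hl; rw [hfl, hfcE, hmMc']
      -- arcs in the lower straight cells are vertical
      have hvert : ∀ m : ℕ, M₀ + 2 ≤ m → m ≤ Mc - 1 → ∀ l < n, ω.2.fc l = (r.1, r.2 - m) →
          ω.2.sOut l = .N ∨ ω.2.sOut l = .S := by
        intro m hm1 hm2 l hl hfl
        have hst := hcolSt m (by omega) (by omega) (by omega) l hl hfl
        obtain ⟨a, ha, hfa, hsa⟩ := hNc m (by omega) (by omega)
        have hal : a = l := by
          by_contra hne
          exact (ω.2.not_straight_of_two_arcs hl ha (Ne.symm hne) (hfa.trans hfl.symm)).1 (ω.2.sOut_of_straight hl hst)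
        subst hal
        have hout := ω.2.sOut_of_straight ha hst
        rcases hsa with h' | h'
        · right; rw [hout, h']; rfl
        · left; exact h'
      ---- the last crossing of column `r.1`: the arc `ls > firstHitG` leaves the column eastwards
      obtain ⟨ls, hls1, hls2, hcls, hcls1, hafter⟩ := ω.2.exists_last_cross (i := ω.2.firstHitG + 1) (j := n - 1)
        (by omega) (by omega) (x := r.1)
        (by rw [(ω.2.fc_succ_eq_of_sOut_W (i := ω.2.firstHitG) (by omega) hWout).1, hfcF]; simp only; omega)
        (by rw [hfcZ]; simp only; omega)
      have hlsn : ls < n := by omega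
      have hlsE : ω.2.sOut ls = .E := ω.2.sOut_eq_E_of_fst_succ (by omega) (by rw [hcls1, hcls])
      have hls_cases : (ls = iq' ∧ ω.2.sOut iq' = .E) ∨ (ls = iE ∧ ω.2.sOut iE = .E) := by
        rcases hCcls ls hlsn hcls with h' | ⟨m, -, -, h'⟩ | (h' | h') | ⟨m, hm1, hm2, h'⟩ | h'
        · exfalso; omega
        · exfalso; omega
        · exfalso; omega
        · exact Or.inl ⟨h', by rw [← h']; exact hlsE⟩
        · exfalso
          rcases hvert m hm1 hm2 ls hlsn h' with h'' | h'' <;> rw [hlsE] at h'' <;> exact absurd h'' (by decide)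
        · exact Or.inr ⟨h', by rw [← h']; exact hlsE⟩
      ---- the crossing is not at `e`: then `e` is entered from `N`, the column read upwards from `e` ends with `q`'s second arc `h' → S`,
      ---- and the walk has no way to be on the side `h'` of the column just before it
      have hls_q : ls = iq' ∧ ω.2.sOut iq' = .E := by
        rcases hls_cases with h' | ⟨hle, hEe⟩
        · exact h'
        exfalso
        have hinE : ω.2.sIn iE = .N := by
          rcases hNE with h' | h'
          · exact h'
          · rw [hEe] at h'; exact absurd h' (by decide)
        have hcellsUp : ∀ j : ℕ, 1 ≤ j → j ≤ Mc - M₀ - 2 → ∀ i < n,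
            ω.2.fc i = ((ω.2.fc iE).1, (ω.2.fc iE).2 + j) → arcKind (ω.2.sIn i) (ω.2.sOut i) = .straight := by
          intro j hj1 hj2 i hi hfi
          rw [hfcE] at hfi
          exact hcolSt (Mc - j) (by omega) (by omega) (by omega) i hi (by rw [hfi]; exact Prod.ext rfl (by simp only; omega))
        have hNL : Mc - M₀ - 2 ≤ iE := by
          by_contra hlt
          push Not at hlt
          obtain ⟨-, hin0⟩ := ω.2.run_back_above_of_straight hiE le_rfl hinE
            (fun j hj1 hj2 i hi hfi => hcellsUp j hj1 (by omega) i hi hfi) iE le_rfl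
          rw [Nat.sub_self, h0W] at hin0; exact absurd hin0 (by decide)
        have hrunUp := ω.2.run_back_above_of_straight hiE hNL hinE hcellsUp
        obtain ⟨hfcu, hinu⟩ := hrunUp (Mc - M₀ - 2) le_rfl
        rw [hfcE] at hfcu
        have h1u : 1 ≤ iE - (Mc - M₀ - 2) := by
          by_contra hlt
          have e0 : iE - (Mc - M₀ - 2) = 0 := by omega
          rw [e0, h0W] at hinu; exact absurd hinu (by decide)
        obtain ⟨hfcq2, houtq2⟩ := fc_sOut_pred_of_sIn_N ω.2 (i := iE - (Mc - M₀ - 2)) (by omega) h1u hinu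
        rw [hfcu] at hfcq2
        have hfcq2' : ω.2.fc (iE - (Mc - M₀ - 2) - 1) = (r.1, w.2) := by
          rw [hfcq2]; exact Prod.ext rfl (by simp only; omega)
        have hq2 : iE - (Mc - M₀ - 2) - 1 = iq' := by
          rcases hqidx _ (by omega) hfcq2' with h' | h'
          · exfalso; rw [h', hNq] at houtq2; exact absurd houtq2 (by decide)
          · exact h'
        rw [hq2] at houtq2
        have hlowidx : ∀ l < n, ∀ m : ℕ, M₀ + 2 ≤ m → m ≤ Mc - 1 → ω.2.fc l = (r.1, r.2 - m) → l = iE - (Mc - m) := by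
          intro l hl m hm1 hm2 hfl
          obtain ⟨hfcm, -⟩ := hrunUp (Mc - m) (by omega)
          rw [hfcE] at hfcm
          have hfcm' : ω.2.fc (iE - (Mc - m)) = (r.1, r.2 - m) := by rw [hfcm]; exact Prod.ext rfl (by simp only; omega)
          by_contra hne
          have := (ω.2.not_straight_of_two_arcs (show iE - (Mc - m) < n by omega) hl (Ne.symm hne) (hfl.trans hfcm'.symm)).1
          exact this (ω.2.sOut_of_straight (by omega) (hcolSt m (by omega) (by omega) (by omega) _ (by omega) hfcm'))
        have hiq'F : ω.2.firstHitG < iq' := by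
          by_contra hge
          push Not at hge
          obtain ⟨j, hj, hjle⟩ : ∃ j : ℕ, ω.2.firstHitG = iE - j ∧ j ≤ Mc - M₀ - 1 := ⟨iE - ω.2.firstHitG, by omega, by omega⟩
          rcases Nat.eq_zero_or_pos j with hj0 | hjpos
          · have e1 : ω.2.fc ω.2.firstHitG = (r.1, r.2 - Mc) := by rw [hj, hj0, Nat.sub_zero, hfcE]
            rw [hfcF] at e1
            have := congrArg Prod.snd e1; simp only at this; omega
          rcases Nat.lt_or_ge j (Mc - M₀ - 1) with hjlt | hjge
          · obtain ⟨hfcj, -⟩ := hrunUp j (by omega)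
            rw [hfcE, ← hj, hfcF] at hfcj
            have := congrArg Prod.snd hfcj; simp only at this; omega
          · have hjq : ω.2.firstHitG = iq' := by omega
            have e1 : ω.2.fc ω.2.firstHitG = (r.1, w.2) := by rw [hjq, hfcq']
            rw [hfcF] at e1
            have := congrArg Prod.snd e1; simp only at this; omega
        have hCidx : ∀ l < n, (ω.2.fc l).1 = r.1 → (iq ≤ l ∧ l ≤ ω.2.firstHitG) ∨ (iq' ≤ l ∧ l ≤ iE) := by
          intro l hl hcol1
          rcases hCcls l hl hcol1 with h' | ⟨m, hm1, hm2, h'⟩ | (h' | h') | ⟨m, hm1, hm2, h'⟩ | h'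
          · left; omega
          · left; omega
          · left; omega
          · right; omega
          · right; have := hlowidx l hl m hm1 hm2 h'; omega
          · right; omega
        rcases hinq with hWin | hEin
        · -- `iq'` is `E → S`: just before it the walk is east of the column, just after the first hit west of it
          have hEq' : ω.2.sIn iq' = .E := by
            have hne := ω.2.sIn_ne_sOut hiq'n
            rw [houtq2] at hne
            rw [hWin] at d1
            revert d1 d2 hne; cases ω.2.sIn iq' <;> decide
          obtain ⟨hfcp, -⟩ := ω.2.fc_pred_eq_of_sIn_E hiq'n (by omega) hEq'
          rw [hfcq'] at hfcp
          have hij : ω.2.firstHitG + 1 ≤ iq' - 1 := by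
            by_contra hlt
            have hqe : iq' - 1 = ω.2.firstHitG := by omega
            rw [hqe, hfcF] at hfcp
            have := congrArg Prod.snd hfcp; simp only at this; omega
          obtain ⟨l, hl1, hl2, hl3⟩ := ω.2.exists_fst_eq_between (i := ω.2.firstHitG + 1) (j := iq' - 1) hij (by omega) (x := r.1)
            (by rw [(ω.2.fc_succ_eq_of_sOut_W (i := ω.2.firstHitG) (by omega) hWout).1, hfcF]; simp only; omega)
            (by rw [hfcp]; simp only; omega)
          rcases hCidx l (by omega) hl3 with h' | h' <;> omega
        · -- `iq` is `E → N`, before the first hit: just before it the walk is east of the column, at the start west of it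
          have hiq1 : 1 ≤ iq := by
            by_contra hlt
            have e0 : iq = 0 := by omega
            rw [e0, h0W] at hEin; exact absurd hEin (by decide)
          obtain ⟨hfcp, -⟩ := ω.2.fc_pred_eq_of_sIn_E hiqn hiq1 hEin
          rw [hfcq] at hfcp
          obtain ⟨l, -, hl2, hl3⟩ := ω.2.exists_fst_eq_between (i := 0) (j := iq - 1) (by omega) (by omega) (x := r.1)
            (by rw [h0w]; omega) (by rw [hfcp]; simp only; omega)
          rcases hCidx l (by omega) hl3 with h' | h' <;> omega
      obtain ⟨hls_eq, hEq'⟩ := hls_q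
      ---- so the crossing is `q`'s second arc `S → E`, after the first hit; below it the column reads downwards back to `e`, left through `N`
      have hSq'' : ω.2.sIn iq' = .S := by
        rcases hSq' with h' | h'
        · exact h'
        · rw [hEq'] at h'; exact absurd h' (by decide)
      have hWin : ω.2.sIn iq = .W := by
        rcases hinq with h' | h'
        · exact h'
        · exfalso; rw [h', hEq'] at d3; exact d3 rfl
      have hcellsDn : ∀ j : ℕ, 1 ≤ j → j ≤ Mc - M₀ - 2 → ∀ i < n,
          ω.2.fc i = ((ω.2.fc iq').1, (ω.2.fc iq').2 - j) → arcKind (ω.2.sIn i) (ω.2.sOut i) = .straight := by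
        intro j hj1 hj2 i hi hfi
        rw [hfcq'] at hfi
        exact hcolSt (M₀ + 1 + j) (by omega) (by omega) (by omega) i hi (by rw [hfi]; exact Prod.ext rfl (by simp only; push_cast; omega))
      have hNL : Mc - M₀ - 2 ≤ iq' := by
        by_contra hlt
        push Not at hlt
        obtain ⟨-, hin0⟩ := ω.2.run_back_below_of_straight hiq'n le_rfl hSq''
          (fun j hj1 hj2 i hi hfi => hcellsDn j hj1 (by omega) i hi hfi) iq' le_rfl
        rw [Nat.sub_self, h0W] at hin0; exact absurd hin0 (by decide)
      have hrunDn := ω.2.run_back_below_of_straight hiq'n hNL hSq'' hcellsDn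
      obtain ⟨hfcd, hind⟩ := hrunDn (Mc - M₀ - 2) le_rfl
      rw [hfcq'] at hfcd
      have h1d : 1 ≤ iq' - (Mc - M₀ - 2) := by
        by_contra hlt
        have e0 : iq' - (Mc - M₀ - 2) = 0 := by omega
        rw [e0, h0W] at hind; exact absurd hind (by decide)
      obtain ⟨hfce2, houte2⟩ := fc_sOut_pred_of_sIn_S ω.2 (i := iq' - (Mc - M₀ - 2)) (by omega) h1d hind
      rw [hfcd] at hfce2
      have hfce2' : ω.2.fc (iq' - (Mc - M₀ - 2) - 1) = (r.1, r.2 - Mc) := by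
        rw [hfce2]; exact Prod.ext rfl (by simp only; omega)
      have he2 : iq' - (Mc - M₀ - 2) - 1 = iE := hsvE _ (by omega) (hfce2'.trans hfcE.symm)
      rw [he2] at houte2
      have hinEW : ω.2.sIn iE = .W ∨ ω.2.sIn iE = .E := by
        have hne := ω.2.sIn_ne_sOut hiE
        rw [houte2] at hne
        revert hninE hne; cases ω.2.sIn iE <;> decide
      have hlowidx : ∀ l < n, ∀ m : ℕ, M₀ + 2 ≤ m → m ≤ Mc - 1 → ω.2.fc l = (r.1, r.2 - m) → l = iq' - (m - M₀ - 1) := by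
        intro l hl m hm1 hm2 hfl
        obtain ⟨hfcm, -⟩ := hrunDn (m - M₀ - 1) (by omega)
        rw [hfcq'] at hfcm
        have hfcm' : ω.2.fc (iq' - (m - M₀ - 1)) = (r.1, r.2 - m) := by
          rw [hfcm]; exact Prod.ext rfl (by simp only; omega)
        by_contra hne
        have := (ω.2.not_straight_of_two_arcs (show iq' - (m - M₀ - 1) < n by omega) hl (Ne.symm hne) (hfl.trans hfcm'.symm)).1
        exact this (ω.2.sOut_of_straight (by omega) (hcolSt m (by omega) (by omega) (by omega) _ (by omega) hfcm'))
      have hiEF : ω.2.firstHitG < iE := by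
        by_contra hge
        push Not at hge
        obtain ⟨j, hj, hjle⟩ : ∃ j : ℕ, ω.2.firstHitG = iq' - j ∧ j ≤ Mc - M₀ - 1 := ⟨iq' - ω.2.firstHitG, by omega, by omega⟩
        rcases Nat.eq_zero_or_pos j with hj0 | hjpos
        · have e1 : ω.2.fc ω.2.firstHitG = (r.1, w.2) := by rw [hj, hj0, Nat.sub_zero, hfcq']
          rw [hfcF] at e1
          have := congrArg Prod.snd e1; simp only at this; omega
        rcases Nat.lt_or_ge j (Mc - M₀ - 1) with hjlt | hjge
        · obtain ⟨hfcj, -⟩ := hrunDn j (by omega)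
          rw [hfcq', ← hj, hfcF] at hfcj
          have := congrArg Prod.snd hfcj; simp only at this; omega
        · have hje : ω.2.firstHitG = iE := by omega
          have e1 : ω.2.fc ω.2.firstHitG = (r.1, r.2 - Mc) := by rw [hje, hfcE]
          rw [hfcF] at e1
          have := congrArg Prod.snd e1; simp only at this; omega
      have hCidx : ∀ l < n, (ω.2.fc l).1 = r.1 → (iq ≤ l ∧ l ≤ ω.2.firstHitG) ∨ (iE ≤ l ∧ l ≤ iq') := by
        intro l hl hcol1
        rcases hCcls l hl hcol1 with h' | ⟨m, hm1, hm2, h'⟩ | (h' | h') | ⟨m, hm1, hm2, h'⟩ | h'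
        · left; omega
        · left; omega
        · left; omega
        · right; omega
        · right; have := hlowidx l hl m hm1 hm2 h'; omega
        · right; omega
      -- `e` is entered from `W`
      have hinEWest : ω.2.sIn iE = .W := by
        rcases hinEW with h' | hEin
        · exact h'
        exfalso
        obtain ⟨hfcp, -⟩ := ω.2.fc_pred_eq_of_sIn_E hiE (by omega) hEin
        rw [hfcE] at hfcp
        have hij : ω.2.firstHitG + 1 ≤ iE - 1 := by
          by_contra hlt
          have hqe : iE - 1 = ω.2.firstHitG := by omega
          rw [hqe, hfcF] at hfcp
          have := congrArg Prod.snd hfcp; simp only at this; omega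
        obtain ⟨l, hl1, hl2, hl3⟩ := ω.2.exists_fst_eq_between (i := ω.2.firstHitG + 1) (j := iE - 1) hij (by omega) (x := r.1)
          (by rw [(ω.2.fc_succ_eq_of_sOut_W (i := ω.2.firstHitG) (by omega) hWout).1, hfcF]; simp only; omega)
          (by rw [hfcp]; simp only; omega)
        rcases hCidx l (by omega) hl3 with h' | h' <;> omega
      -- before `iq'` the walk is never strictly east of the column
      have hbefore : ∀ l < n, r.1 < (ω.2.fc l).1 → iq' < l := by
        intro l hl hgt
        by_contra hle
        push Not at hle
        have hne : (ω.2.fc l).1 ≠ r.1 := by omega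
        rcases Nat.lt_or_ge l iq with hlq | hlq
        · obtain ⟨l', -, hl'2, hl'3⟩ := ω.2.exists_fst_eq_between (i := 0) (j := l) (by omega) hl (x := r.1)
            (by rw [h0w]; omega) hgt.le
          rcases hCidx l' (by omega) hl'3 with h' | h' <;> omega
        rcases Nat.lt_or_ge ω.2.firstHitG l with hlf | hlf
        · rcases Nat.lt_or_ge l iE with hle' | hle'
          · obtain ⟨l', hl'1, hl'2, hl'3⟩ := ω.2.exists_fst_eq_between (i := ω.2.firstHitG + 1) (j := l) (by omega) hl (x := r.1)
              (by rw [(ω.2.fc_succ_eq_of_sOut_W (i := ω.2.firstHitG) (by omega) hWout).1, hfcF]; simp only; omega) hgt.le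
            rcases hCidx l' (by omega) hl'3 with h' | h' <;> omega
          · obtain ⟨j, hj⟩ : ∃ j : ℕ, l = iq' - j ∧ j ≤ Mc - M₀ - 1 := ⟨iq' - l, by omega, by omega⟩
            rcases Nat.lt_or_ge j (Mc - M₀ - 1) with hjlt | hjge
            · obtain ⟨hfcj, -⟩ := hrunDn j (by omega)
              rw [hfcq', ← hj.1] at hfcj
              apply hne; rw [hfcj]
            · have : l = iE := by omega
              apply hne; rw [this, hfcE]
        · obtain ⟨j, hj⟩ : ∃ j : ℕ, l = ω.2.firstHitG - j ∧ j ≤ M₀ + 1 := ⟨ω.2.firstHitG - l, by omega, by omega⟩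
          rcases Nat.lt_or_ge j (M₀ + 1) with hjlt | hjge
          · obtain ⟨hfcj, -⟩ := hrunS j (by omega)
            rw [hfcF, ← hj.1] at hfcj
            apply hne; rw [hfcj]
          · have : l = iq := by omega
            apply hne; rw [this, hfcq]
      ---- `e` is an exit turn of the bottom row entered from `W`: it is `b₁` or an outsider; a bottom arc after `e` makes it an outsider
      have he_b₀ : (((r.1 : ℤ), r.2 - Mc) : Face) ≠ ω.2.fc j₀ := by
        intro e
        have := hsvE j₀ hj₀ (e.symm.trans hfcE.symm)
        rw [this, hinEWest] at hN₀'
        exact absurd hN₀' (by decide)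
      have he_out : (((r.1 : ℤ), r.2 - Mc) : Face) ≠ ω.2.fc j₁ →
          (((r.1 : ℤ), r.2 - Mc) : Face) ≠ ((r.1 : ℤ) - M, r.2) ∧ (((r.1 : ℤ), r.2 - Mc) : Face) ≠ r ∧
            (((r.1 : ℤ), r.2 - Mc) : Face) ≠ ω.2.fc j₀ ∧ (((r.1 : ℤ), r.2 - Mc) : Face) ≠ ω.2.fc j₁ ∧
            (((r.1 : ℤ), r.2 - Mc) : Face) ≠ ((τ1 : ℤ), w.2) := fun hne =>
        ⟨hne_of_row _ _ (by simp only; omega), hne_of_row _ _ (by simp only; omega), he_b₀, hne, hne_of_row _ _ (by simp only; omega)⟩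
      have hlate : ∀ a < n, (ω.2.fc a).2 = Y' → iE < a → (((r.1 : ℤ), r.2 - Mc) : Face) ≠ ω.2.fc j₁ := by
        intro a ha hrow hlt e
        have := hsvE j₁ hj₁ (e.symm.trans hfcE.symm)
        exact hmax₁ a (by omega) ha hrow
      ---- from `q` the walk runs east along the root row into `τ`: the cells in between are straight
      have hrowStE : ∀ m : ℕ, 1 ≤ m → (m : ℤ) < τ1 - r.1 → ∀ i < n, ω.2.fc i = (r.1 + m, w.2) →
          arcKind (ω.2.sIn i) (ω.2.sOut i) = .straight := by
        intro m hm1 hm2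
        have hcW : ω.2.UsesSide (r.1 + m, w.2) .W := by
          have := hτWs ((r.1 - (w.1 + k)).toNat + m) (by omega) (by push_cast; omega)
          rwa [show (w.1 : ℤ) + k + (((r.1 - (w.1 + k)).toNat + m : ℕ) : ℤ) = r.1 + m by push_cast; omega] at this
        have hcE : ω.2.UsesSide (r.1 + m, w.2) .E := by
          have := hτEs ((r.1 - (w.1 + k)).toNat + m) (by push_cast; omega)
          rwa [show (w.1 : ℤ) + k + (((r.1 - (w.1 + k)).toNat + m : ℕ) : ℤ) = r.1 + m by push_cast; omega] at this
        refine ω.2.straight_of_usesSide_EW (s := .N) hcE hcW ?_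
        intro hcN
        obtain ⟨Mv, hMv1, hMvrow, hPξ, -, -, -, hξUses, -⟩ := hNend _ _ hcN
        have hξtop := hNtop_of _ _ _ hPξ le_rfl hMvrow hξUses hMv1
        rw [hξtop] at hPξ
        obtain ⟨o1, o2, o3, o4, o5⟩ := hout_top (((r.1 : ℤ) + m, r.2) : Face) rfl (by simp only; omega)
        -- the kiss uses `S`; its `S`-chain ends on the bottom row, late
        have hcS : ω.2.UsesSide (r.1 + m, w.2) .S := by
          by_contra hnS
          obtain ⟨a, ha, hfa, hsa⟩ := hcN
          obtain ⟨b, hb, hfb, hsb⟩ := hcW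
          obtain ⟨c, hc', hfc', hsc⟩ := hcE
          have eab := ω.2.single_visit_of_not_usesSide hnS ha hb hfa hfb
          have eac := ω.2.single_visit_of_not_usesSide hnS ha hc' hfa hfc'
          subst eab; subst eac
          have hne := ω.2.sIn_ne_sOut ha
          revert hsa hsb hsc hne; cases ω.2.sIn a <;> cases ω.2.sOut a <;> decide
        obtain ⟨Mu, hMu1, hMurow, hPη, -, -, -, hηUses, iη, hiη, hfcη, -, -, -⟩ := hSend _ _ hcS
        have hηbot := hSbot_of _ _ _ hPη le_rfl hMurow hηUses hMu1
        have hiηlate : iq' < iη := hbefore iη hiη (by rw [hfcη]; simp only; omega)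
        have heb₁ := hlate iη hiη (by rw [hfcη]; simp only; exact hηbot) (by omega)
        obtain ⟨e1, e2, e3, e4, e5⟩ := he_out heb₁
        exact houts _ _ hPξ hPe (hne_of_row _ _ (by simp only; omega)) o1 o2 o3 o4 o5 e1 e2 e3 e4 e5
      set T : ℕ := (τ1 - r.1).toNat with hT
      have hT' : (T : ℤ) = τ1 - r.1 := by omega
      have hcellsT : ∀ m : ℕ, 1 ≤ m → m ≤ T - 1 → ∀ i < n,
          ω.2.fc i = ((ω.2.fc iq').1 + m, (ω.2.fc iq').2) → arcKind (ω.2.sIn i) (ω.2.sOut i) = .straight := by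
        intro m hm1 hm2 i hi hfi; rw [hfcq'] at hfi; exact hrowStE m hm1 (by omega) i hi hfi
      have hqTn : iq' + T < n := by
        by_contra hge
        push Not at hge
        obtain ⟨hfcL, -⟩ := ω.2.run_east_of_straight (j := iq') (M := n - 1 - iq') (by omega) hEq'
          (fun m hm1 hmM i hi hfi => hcellsT m hm1 (by omega) i hi hfi) (n - 1 - iq') le_rfl
        rw [show iq' + (n - 1 - iq') = n - 1 by omega, hfcZ, hfcq'] at hfcL
        have := congrArg Prod.snd hfcL; simp only at this; omega
      obtain ⟨hfcL, houtL⟩ := ω.2.run_east_of_straight (j := iq') (M := T - 1) (by omega) hEq' hcellsT _ le_rfl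
      rw [hfcq'] at hfcL
      obtain ⟨hfcτ', hinτ⟩ := ω.2.fc_succ_eq_of_sOut_E (i := iq' + (T - 1)) (by omega) houtL
      rw [hfcL, show iq' + (T - 1) + 1 = iq' + T by omega] at hfcτ'
      rw [show iq' + (T - 1) + 1 = iq' + T by omega] at hinτ
      have hfcτ : ω.2.fc (iq' + T) = ((τ1 : ℤ), w.2) := by rw [hfcτ']; exact Prod.ext (by simp only; omega) (by simp only)
      set iτ := iq' + T with hiτdef
      have hτNS : ω.2.sOut iτ = .N ∨ ω.2.sOut iτ = .S := by
        have hne := ω.2.sIn_ne_sOut hqTn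
        rw [hinτ] at hne
        have hnE : ω.2.sOut iτ ≠ .E := fun e => hτnE ⟨iτ, hqTn, hfcτ, Or.inr e⟩
        revert hne hnE; cases ω.2.sOut iτ <;> decide
      rcases hτNS with hτN | hτS
      swap
      · ---- `τ` left downwards: straight down into the bottom row at an entry turn after `e`; so `e` is an outsider, that turn is `b₀`, and `b₁`,
        ---- later still and east of the column, sends its `N`-chain to a further outsider
        obtain ⟨Mu, hMu1, hMurow, hPη, hNη, hSη, -, hηUses, -⟩ := hSend _ _ ⟨iτ, hqTn, hfcτ, Or.inr hτS⟩
        have hηbot := hSbot_of _ _ _ hPη le_rfl hMurow hηUses hMu1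
        have hcellsτ : ∀ m : ℕ, 1 ≤ m → m ≤ Mu - 1 → ∀ i < n,
            ω.2.fc i = ((ω.2.fc iτ).1, (ω.2.fc iτ).2 - m) → arcKind (ω.2.sIn i) (ω.2.sOut i) = .straight := by
          intro m hm1 hm2 i hi hfi
          rw [hfcτ] at hfi
          exact ω.2.straight_of_usesSide_NS (hNη m hm1 (by omega)) (hSη m (by omega))
            (fun hW => hWkill _ _ hW (by omega) (by omega) (by omega)) i hi hfi
        have hτMn : iτ + Mu < n := by
          by_contra hge
          push Not at hge
          obtain ⟨hfcL', -⟩ := ω.2.run_down_of_straight (j := iτ) (M := n - 1 - iτ) (by omega) hτS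
            (fun m hm1 hmM i hi hfi => hcellsτ m hm1 (by omega) i hi hfi) (n - 1 - iτ) le_rfl
          rw [show iτ + (n - 1 - iτ) = n - 1 by omega, hfcZ, hfcτ] at hfcL'
          have := congrArg Prod.snd hfcL'; simp only at this; omega
        obtain ⟨hfcL', houtL'⟩ := ω.2.run_down_of_straight (j := iτ) (M := Mu - 1) (by omega) hτS hcellsτ _ le_rfl
        rw [hfcτ] at hfcL'
        have hfcη' := ω.2.fc_succ_eq_of_sOut_S (i := iτ + (Mu - 1)) (by omega) houtL'
        have hinη := sIn_succ_of_sOut_S ω.2 (i := iτ + (Mu - 1)) (by omega) houtL'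
        rw [hfcL', show iτ + (Mu - 1) + 1 = iτ + Mu by omega] at hfcη'
        rw [show iτ + (Mu - 1) + 1 = iτ + Mu by omega] at hinη
        have hfcη : ω.2.fc (iτ + Mu) = ((τ1 : ℤ), Y') := by
          rw [hfcη']; exact Prod.ext (by simp only) (by simp only; omega)
        obtain ⟨e1, e2, e3, e4, e5⟩ := he_out (hlate _ hτMn (by rw [hfcη]) (by omega))
        rw [hηbot] at hPη
        have hηb₀ : (((τ1 : ℤ), Y') : Face) = ω.2.fc j₀ := by
          by_contra hne0
          have hne1 : (((τ1 : ℤ), Y') : Face) ≠ ω.2.fc j₁ := by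
            intro e
            have := hsvB j₁ hj₁ hrow₁' _ hτMn (hfcη.trans e)
            rw [this] at hinη
            rcases hWE₁' with h' | h' <;> rw [hinη] at h' <;> exact absurd h' (by decide)
          exact houts _ _ hPe hPη (fun e => by have := congrArg Prod.fst e; simp only at this; omega) e1 e2 e3 e4 e5
            (hne_of_row _ _ (by simp only; omega)) (hne_of_row _ _ (by simp only; omega)) hne0 hne1
            (hne_of_row _ _ (by simp only; omega))
        have hj₀late : iq' < j₀ := by
          have := hsvB j₀ hj₀ hrow₀' _ hτMn (hfcη.trans hηb₀); omega
        have hb₁col : r.1 < (ω.2.fc j₁).1 := hafter j₁ (by omega) (by omega)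
        obtain ⟨Mz, hMz1, hMzrow, hPζ, -, -, -, hζUses, -⟩ := hNend (ω.2.fc j₁).1 (ω.2.fc j₁).2 ⟨j₁, hj₁, rfl, Or.inr hN₁'⟩
        rw [hrow₁'] at hMzrow hPζ hζUses
        rcases lt_trichotomy (Y' + (Mz : ℤ)) w.2 with hzlt | hzeq | hzgt
        · exact hmid_kill _ hPζ (by simp only; omega) (by simp only; omega) (by simp only; omega) hζUses
        · rw [hzeq] at hPζ hζUses
          have hcolne : (ω.2.fc j₁).1 ≠ τ1 := by
            intro e
            apply hfne'
            rw [← hηb₀]; exact (Prod.ext e hrow₁').symm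
          exact houts _ _ hPe hPζ (hne_of_row _ _ (by simp only; omega)) e1 e2 e3 e4 e5
            (hne_of_row _ _ (by simp only; omega)) (hne_of_row _ _ (by simp only; omega))
            (hne_of_row _ _ (by rw [hrow₀']; simp only; omega)) (hne_of_row _ _ (by rw [hrow₁']; simp only; omega))
            (fun e => hcolne (by have := congrArg Prod.fst e; simpa using this))
        · rcases lt_or_eq_of_le hMzrow with hlt' | heq'
          · exact hmid_kill _ hPζ (by simp only; omega) (by simp only; exact hlt') (by simp only; omega) hζUses
          · rw [heq'] at hPζ
            obtain ⟨o1, o2, o3, o4, o5⟩ := hout_top (((ω.2.fc j₁).1, r.2) : Face) rfl hb₁col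
            exact houts _ _ hPe hPζ (hne_of_row _ _ (by simp only; omega)) e1 e2 e3 e4 e5 o1 o2 o3 o4 o5
      ---- `τ` left upwards: its `N`-chain ends at a top-row outsider `o` east of `r`; hence `e = b₁`, and the column of `p₁` decides
      obtain ⟨Mo, hMo1, hMorow, hPo, -, -, -, hoUses, -⟩ := hNend _ _ ⟨iτ, hqTn, hfcτ, Or.inr hτN⟩
      have hotop := hNtop_of _ _ _ hPo le_rfl hMorow hoUses hMo1
      rw [hotop] at hPo
      obtain ⟨o1, o2, o3, o4, o5⟩ := hout_top (((τ1 : ℤ), r.2) : Face) rfl (by simp only; omega)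
      have hkillO : ∀ g : Face, P g → g.1 < τ1 →
          g ≠ ((r.1 : ℤ) - M, r.2) → g ≠ r → g ≠ ω.2.fc j₀ → g ≠ ω.2.fc j₁ → g ≠ ((τ1 : ℤ), w.2) → False :=
        fun g hPg hg a1 a2 a3 a4 a5 => houts _ _ hPo hPg (fun e => by have := congrArg Prod.fst e; simp only at this; omega)
          o1 o2 o3 o4 o5 a1 a2 a3 a4 a5
      have heb₁ : (((r.1 : ℤ), r.2 - Mc) : Face) = ω.2.fc j₁ := by
        by_contra hne
        obtain ⟨e1, e2, e3, e4, e5⟩ := he_out hne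
        exact hkillO _ hPe (by simp only; omega) e1 e2 e3 e4 e5
      rcases hkNS with hkN | hkS
      · ---- case A: `p₁` left upwards at index `k`: the walk climbs straight into `t` from below — but `t` is entered from `E`
        obtain ⟨Mv, hMv1, hMvrow, hPξ, hSv, hNv, -, hξUses, -⟩ := hNend _ _ ⟨k, hk₁, hfk, Or.inr hkN⟩
        have hξtop := hNtop_of _ _ _ hPξ le_rfl hMvrow hξUses hMv1
        rw [hξtop] at hPξ
        have hkt : (w.1 : ℤ) + k = r.1 - M := by
          by_contra hne
          exact hkillO _ hPξ (by simp only; omega) (fun e => hne (by have := congrArg Prod.fst e; simpa using this))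
            (fun e => by have := congrArg Prod.fst e; simp only at this; omega)
            (hne_of_row _ _ (by rw [hrow₀']; simp only; omega)) (hne_of_row _ _ (by rw [hrow₁']; simp only; omega))
            (hne_of_row _ _ (by simp only; omega))
        have hpcol : ∀ m : ℕ, 1 ≤ m → m ≤ Mv - 1 → ∀ i < n,
            ω.2.fc i = ((ω.2.fc k).1, (ω.2.fc k).2 + m) → arcKind (ω.2.sIn i) (ω.2.sOut i) = .straight := by
          intro m hm1 hm2 i hi hfi
          rw [hfk] at hfi
          exact ω.2.straight_of_usesSide_NS (hNv m (by omega)) (hSv m hm1 (by omega))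
            (fun hW => hWkill _ _ hW (by omega) (by omega) (by omega)) i hi hfi
        have hkMn : k + Mv < n := by
          by_contra hge
          push Not at hge
          obtain ⟨hfcL', -⟩ := ω.2.run_up_of_straight (j := k) (M := n - 1 - k) (by omega) hkN
            (fun m hm1 hmM i hi hfi => hpcol m hm1 (by omega) i hi hfi) (n - 1 - k) le_rfl
          rw [show k + (n - 1 - k) = n - 1 by omega, hfcZ, hfk] at hfcL'
          have := congrArg Prod.fst hfcL'; simp only at this; omega
        obtain ⟨hfcL', houtL'⟩ := ω.2.run_up_of_straight (j := k) (M := Mv - 1) (by omega) hkN hpcol _ le_rfl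
        rw [hfk] at hfcL'
        have hfct' := ω.2.fc_succ_eq_of_sOut_N (i := k + (Mv - 1)) (by omega) houtL'
        have hint' := sIn_succ_of_sOut_N ω.2 (i := k + (Mv - 1)) (by omega) houtL'
        rw [hfcL', show k + (Mv - 1) + 1 = k + Mv by omega] at hfct'
        rw [show k + (Mv - 1) + 1 = k + Mv by omega] at hint'
        have hfct'' : ω.2.fc (k + Mv) = (r.1 - M, r.2) := by
          rw [hfct']; exact Prod.ext (by simp only; omega) (by simp only; omega)
        have := hsvT _ hkMn (hfct''.trans hfcT.symm)
        rw [this, hinT] at hint'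
        exact absurd hint' (by decide)
      · ---- case B: `p₁` left downwards at index `k`: straight down into `b₀`, then along the bottom row — into `e` before the first hit, or off the box
        obtain ⟨Mv, hMv1, hMvrow, hPη, hNv, hSv, -, hηUses, -⟩ := hSend _ _ ⟨k, hk₁, hfk, Or.inr hkS⟩
        have hηbot := hSbot_of _ _ _ hPη le_rfl hMvrow hηUses hMv1
        rw [hηbot] at hPη
        have hηb₀ : (((w.1 : ℤ) + k, Y') : Face) = ω.2.fc j₀ := by
          by_contra hne
          refine hkillO _ hPη (by simp only; omega) (hne_of_row _ _ (by simp only; omega)) (hne_of_row _ _ (by simp only; omega)) hne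
            (fun e => ?_) (hne_of_row _ _ (by simp only; omega))
          rw [← heb₁] at e; have := congrArg Prod.fst e; simp only at this; omega
        have hpcol : ∀ m : ℕ, 1 ≤ m → m ≤ Mv - 1 → ∀ i < n,
            ω.2.fc i = ((ω.2.fc k).1, (ω.2.fc k).2 - m) → arcKind (ω.2.sIn i) (ω.2.sOut i) = .straight := by
          intro m hm1 hm2 i hi hfi
          rw [hfk] at hfi
          exact ω.2.straight_of_usesSide_NS (hNv m hm1 (by omega)) (hSv m (by omega))
            (fun hW => hWkill _ _ hW (by omega) (by omega) (by omega)) i hi hfi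
        have hkMn : k + Mv < n := by
          by_contra hge
          push Not at hge
          obtain ⟨hfcL', -⟩ := ω.2.run_down_of_straight (j := k) (M := n - 1 - k) (by omega) hkS
            (fun m hm1 hmM i hi hfi => hpcol m hm1 (by omega) i hi hfi) (n - 1 - k) le_rfl
          rw [show k + (n - 1 - k) = n - 1 by omega, hfcZ, hfk] at hfcL'
          have := congrArg Prod.fst hfcL'; simp only at this; omega
        have hrunk := ω.2.run_down_of_straight (j := k) (M := Mv - 1) (by omega) hkS hpcol
        obtain ⟨hfcL', houtL'⟩ := hrunk _ le_rfl
        rw [hfk] at hfcL'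
        have hfcb' := ω.2.fc_succ_eq_of_sOut_S (i := k + (Mv - 1)) (by omega) houtL'
        rw [hfcL', show k + (Mv - 1) + 1 = k + Mv by omega] at hfcb'
        have hfcb : ω.2.fc (k + Mv) = (((w.1 : ℤ) + k, Y') : Face) := by
          rw [hfcb']; exact Prod.ext (by simp only) (by simp only; omega)
        have hj₀k : k + Mv = j₀ := hsvB j₀ hj₀ hrow₀' _ hkMn (hfcb.trans hηb₀)
        -- the bottom-row cells west of `e` other than `b₀` carry straight arcs (another turn there would be a seventh isolated turn)
        have hbotSt : ∀ x : ℤ, x ≠ w.1 + k → x < r.1 → ∀ i < n, ω.2.fc i = (x, Y') → arcKind (ω.2.sIn i) (ω.2.sOut i) = .straight := by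
          intro x hx1 hx2 i hi hfi
          by_contra hk'
          have hP' : P (x, Y') := by rw [← hfi]; exact hPiso i hi (hsvB i hi (by rw [hfi])) hk'
          have hn0 : (((x : ℤ), Y') : Face) ≠ ω.2.fc j₀ := fun e => by
            rw [← hηb₀] at e; have := congrArg Prod.fst e; simp only at this; omega
          have hn1 : (((x : ℤ), Y') : Face) ≠ ω.2.fc j₁ := fun e => by
            rw [← heb₁] at e; have := congrArg Prod.fst e; simp only at this; omega
          exact hkillO _ hP' (by simp only; omega) (hne_of_row _ _ (by simp only; omega)) (hne_of_row _ _ (by simp only; omega)) hn0 hn1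
            (hne_of_row _ _ (by simp only; omega))
        rcases hWE₀' with hb₀W | hb₀E
        · -- west along the bottom row, off the bounding box
          set Mw : ℕ := (w.1 + k - X + 1).toNat with hMw
          have hcellsB : ∀ m : ℕ, 1 ≤ m → m ≤ Mw → ∀ i < n,
              ω.2.fc i = ((ω.2.fc j₀).1 - m, (ω.2.fc j₀).2) → arcKind (ω.2.sIn i) (ω.2.sOut i) = .straight := by
            intro m hm1 hm2 i hi hfi
            rw [← hηb₀] at hfi
            exact hbotSt ((w.1 : ℤ) + k - m) (by omega) (by omega) i hi (by rw [hfi])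
          have hbMn : j₀ + Mw < n := by
            by_contra hge
            push Not at hge
            obtain ⟨hfcL'', -⟩ := ω.2.run_west_of_straight (j := j₀) (M := n - 1 - j₀) (by omega) hb₀W
              (fun m hm1 hmM i hi hfi => hcellsB m hm1 (by omega) i hi hfi) (n - 1 - j₀) le_rfl
            rw [show j₀ + (n - 1 - j₀) = n - 1 by omega, hfcZ, ← hηb₀] at hfcL''
            have := congrArg Prod.snd hfcL''; simp only at this; omega
          obtain ⟨hfcL'', -⟩ := ω.2.run_west_of_straight (j := j₀) (M := Mw) hbMn hb₀W hcellsB Mw le_rfl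
          rw [← hηb₀] at hfcL''
          have := hX _ hbMn
          rw [hfcL''] at this
          simp only at this; omega
        · -- east along the bottom row, into `e` before the first hit
          set Me : ℕ := (r.1 - (w.1 + k)).toNat with hMe
          have hcellsB : ∀ m : ℕ, 1 ≤ m → m ≤ Me - 1 → ∀ i < n,
              ω.2.fc i = ((ω.2.fc j₀).1 + m, (ω.2.fc j₀).2) → arcKind (ω.2.sIn i) (ω.2.sOut i) = .straight := by
            intro m hm1 hm2 i hi hfi
            rw [← hηb₀] at hfi
            exact hbotSt ((w.1 : ℤ) + k + m) (by omega) (by omega) i hi (by rw [hfi])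
          have hbMn : j₀ + Me < n := by
            by_contra hge
            push Not at hge
            obtain ⟨hfcL'', -⟩ := ω.2.run_east_of_straight (j := j₀) (M := n - 1 - j₀) (by omega) hb₀E
              (fun m hm1 hmM i hi hfi => hcellsB m hm1 (by omega) i hi hfi) (n - 1 - j₀) le_rfl
            rw [show j₀ + (n - 1 - j₀) = n - 1 by omega, hfcZ, ← hηb₀] at hfcL''
            have := congrArg Prod.snd hfcL''; simp only at this; omega
          have hrunb := ω.2.run_east_of_straight (j := j₀) (M := Me - 1) (by omega) hb₀E hcellsB
          obtain ⟨hfcL'', houtL''⟩ := hrunb _ le_rfl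
          rw [← hηb₀] at hfcL''
          obtain ⟨hfce3, -⟩ := ω.2.fc_succ_eq_of_sOut_E (i := j₀ + (Me - 1)) (by omega) houtL''
          rw [hfcL'', show j₀ + (Me - 1) + 1 = j₀ + Me by omega] at hfce3
          have hfce3' : ω.2.fc (j₀ + Me) = (r.1, r.2 - Mc) := by
            rw [hfce3]; exact Prod.ext (by simp only; omega) (by simp only; omega)
          have hjE : j₀ + Me = iE := hsvE _ hbMn (hfce3'.trans hfcE.symm)
          -- the first hit lies strictly between `k` and `iE`: in the column of `p₁` or on the bottom row — never at `r`
          obtain ⟨j, hj⟩ : ∃ j : ℕ, ω.2.firstHitG = k + j := ⟨ω.2.firstHitG - k, by omega⟩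
          rcases Nat.lt_or_ge j Mv with hjv | hjv
          · obtain ⟨hfcj, -⟩ := hrunk j (by omega)
            rw [hfk, ← hj, hfcF] at hfcj
            have := congrArg Prod.snd hfcj; simp only at this; omega
          rcases Nat.lt_or_ge j (Mv + Me) with hje | hje
          · obtain ⟨hfcj, -⟩ := hrunb (j - Mv) (by omega)
            rw [← hηb₀, show j₀ + (j - Mv) = ω.2.firstHitG by omega, hfcF] at hfcj
            have := congrArg Prod.snd hfcj; simp only at this; omega
          · omega

end ΩG

end Literature.Probability.RandomPlanarGeometry.SAW.YangBaxter
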